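import Literature.NumberTheory.Automorphic.BLZPeriodCocycleProofs
import Literature.Analysis.Complex.RectangleContourTools

/-!
# Towards BLZ Proposition 5.1 — holomorphy of the canonical integral

Bruggeman, Lewis and Zagier, *Period functions for Maass wave forms and cohomology*,
Mem. AMS 237 no. 1118 (2015) [BruggemanLewisZagier2015], Proposition 5.1 (p. 30; proof p. 31):
"If the discrete subgroup `Γ ⊂ G` is infinite, then `r`, `p` and `q` are injective."
This file continues `BLZPeriodCocycleProofs.lean` (§1–§8 there; the statement is the named fact
`BruggemanLewisZagier2015_prop_5_1` in `BLZPeriodCocycle.lean`) with §9–§14 of the road map: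
the analytic core of the canonical hybrid model of the companion paper (Bruggeman–Lewis–Zagier,
*Function theory related to the group PSL₂(ℝ)*, §4.2, Thm 4.2), namely that for `u ∈ E_s`
the canonical integral `η ↦ ∫_{z₀}^{η} [u, (R_η/R_η(z₀))^s]` is holomorphic on `ℍ ∖ {z₀}`.

## What is here (all proved)

* §9–§10: Wirtinger calculus (`wirtingerDzbar_mul`, `wirtingerDzbar_comp_outer`,
  `wirtingerDzbar_of_hasDerivAt`, …, `wirtingerDzbar_ratioKernel`) and the segment form of the
  integrand: `greenForm_ratioKernel_segment` (`[u, (R_η/R_η(z₀))^s](ℓ(τ)) = (1-τ)^{-s} G(τ, η)`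
  with `G` smooth), `intervalIntegrable_greenForm_ratioKernel`;
* §11–§12: `hasFDerivAt_integral_mul_of_contDiffOn` (differentiation under `∫₀¹ p(τ) G(τ, η) dτ`
  with an integrable singular weight `p`), `contDiffOn_regularPart`;
* §13–§14: `hasFDerivAt_truncatedCanonical`, `exists_bound_dbar_coeff`,
  `differentiableAt_complex_of_dbar_zero` and **`differentiableAt_canonicalIntegral`**: for
  `u ∈ E_s^Γ` and `Re s < 1`, `s ≠ 0, 1`, the canonical integral
  `η ↦ ∫_{z₀}^{η} [u, (R_η/R_η(z₀))^s]` is complex-differentiable at every `η₀ ∈ ℍ ∖ {z₀}`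
  (companion paper, Thm 4.2: holomorphy of the canonical representative) — the `∂̄`-part of the
  real derivative of the truncated integrals `∫₀ᶜ` is `O((1-c)^{1-Re s})` as `c → 1⁻`;
* §15: `exists_norm_canonicalIntegral_le` (`O(|η - z₀|)` at the base point),
  `differentiableAt_canonicalIntegral_base` (removable singularity) and
  **`differentiableOn_canonicalIntegral`**: the canonical integral is holomorphic on all of `ℍ`;
* §16: `IsInvariantEigenfunction.conj` (`u ∈ E_s^Γ ⇒ ū ∈ E_{s̄}^Γ`) and
  `differentiableOn_conj_canonicalIntegral`: the Schwarz reflection of the canonical integral of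
  the conjugate system — the lower-half-plane representative — is holomorphic on `{Im η < 0}`.

## References

* [BruggemanLewisZagier2015] R. Bruggeman, J. Lewis, D. Zagier, *Period functions for Maass wave
  forms and cohomology*, Mem. Amer. Math. Soc. 237 (2015), no. 1118, doi:10.1090/memo/1118:
  (1.7) p. 10; (1.10) p. 11; Proposition 5.1 pp. 30–31.
* R. Bruggeman, J. Lewis, D. Zagier, *Function theory related to the group PSL₂(ℝ)*, in
  *From Fourier analysis and number theory to Radon transforms and geometry*, Dev. Math. 28,
  Springer (2013), 107–201, §4.2, Theorem 4.2.
-/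

noncomputable section

namespace Literature.NumberTheory.Automorphic

open _root_.UpperHalfPlane _root_.Complex _root_.Filter _root_.Set _root_.MeasureTheory
open scoped MatrixGroups Topology ComplexConjugate
open Laplacian

/-! ## 9. Wirtinger calculus: product and chain rules, `∂̄` of the ratio kernel ((4.24) of the
companion paper), and `∫ [U, V] + ∫ [V, U] = [U V]` ((1.10b)) -/

section WirtingerCalculus

variable {f g : ℂ → ℂ} {w : ℂ}

/-- Product rule for `∂/∂z̄`. [folklore] -/
theorem wirtingerDzbar_mul (hf : DifferentiableAt ℝ f w) (hg : DifferentiableAt ℝ g w) :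
    wirtingerDzbar (f * g) w = f w * wirtingerDzbar g w + g w * wirtingerDzbar f w := by
  simp only [wirtingerDzbar, (hf.hasFDerivAt.mul hg.hasFDerivAt).fderiv, add_apply, smul_apply,
    smul_eq_mul]
  ring

/-- Product rule for `∂/∂z`. [folklore] -/
theorem wirtingerDz_mul (hf : DifferentiableAt ℝ f w) (hg : DifferentiableAt ℝ g w) :
    wirtingerDz (f * g) w = f w * wirtingerDz g w + g w * wirtingerDz f w := by
  simp only [wirtingerDz, (hf.hasFDerivAt.mul hg.hasFDerivAt).fderiv, add_apply, smul_apply,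
    smul_eq_mul]
  ring

/-- Chain rule for `∂/∂z̄` with a holomorphic outer function: `∂̄(φ ∘ b) = φ'(b) ∂̄b`. [folklore] -/
theorem wirtingerDzbar_comp_outer {φ b : ℂ → ℂ} {φ' : ℂ} (hφ : HasDerivAt φ φ' (b w))
    (hb : DifferentiableAt ℝ b w) :
    wirtingerDzbar (φ ∘ b) w = φ' * wirtingerDzbar b w := by
  have h := (hφ.hasFDerivAt.restrictScalars ℝ).comp w hb.hasFDerivAt
  simp only [wirtingerDzbar, h.fderiv, ContinuousLinearMap.comp_apply,
    ContinuousLinearMap.coe_restrictScalars', ContinuousLinearMap.toSpanSingleton_apply,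
    smul_eq_mul]
  ring

/-- Chain rule for `∂/∂z` with a holomorphic outer function: `∂(φ ∘ b) = φ'(b) ∂b`. [folklore] -/
theorem wirtingerDz_comp_outer {φ b : ℂ → ℂ} {φ' : ℂ} (hφ : HasDerivAt φ φ' (b w))
    (hb : DifferentiableAt ℝ b w) :
    wirtingerDz (φ ∘ b) w = φ' * wirtingerDz b w := by
  have h := (hφ.hasFDerivAt.restrictScalars ℝ).comp w hb.hasFDerivAt
  simp only [wirtingerDz, h.fderiv, ContinuousLinearMap.comp_apply,
    ContinuousLinearMap.coe_restrictScalars', ContinuousLinearMap.toSpanSingleton_apply,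
    smul_eq_mul]
  ring

/-- `∂̄` of a complex-differentiable function vanishes. [folklore] -/
theorem wirtingerDzbar_of_hasDerivAt {F' : ℂ} (h : HasDerivAt f F' w) : wirtingerDzbar f w = 0 := by
  simp only [wirtingerDzbar, fderiv_real_apply_of_hasDerivAt h]
  linear_combination (F' / 2) * Complex.I_mul_I

/-- `∂` of a complex-differentiable function is its derivative. [folklore] -/
theorem wirtingerDz_of_hasDerivAt {F' : ℂ} (h : HasDerivAt f F' w) : wirtingerDz f w = F' := by
  simp only [wirtingerDz, fderiv_real_apply_of_hasDerivAt h]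
  linear_combination (-F' / 2) * Complex.I_mul_I

/-- `∂̄ (conj ∘ F) = conj F'` for complex-differentiable `F`. [folklore] -/
theorem wirtingerDzbar_conj_of_hasDerivAt {F' : ℂ} (h : HasDerivAt f F' w) :
    wirtingerDzbar (fun z => conj (f z)) w = conj F' := by
  simp only [wirtingerDzbar, fderiv_real_conj_apply_of_hasDerivAt h, map_mul, Complex.conj_I,
    map_one]
  linear_combination (-(conj F') / 2) * Complex.I_mul_I

/-- `∂ (conj ∘ F) = 0` for complex-differentiable `F`. [folklore] -/
theorem wirtingerDz_conj_of_hasDerivAt {F' : ℂ} (h : HasDerivAt f F' w) :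
    wirtingerDz (fun z => conj (f z)) w = 0 := by
  simp only [wirtingerDz, fderiv_real_conj_apply_of_hasDerivAt h, map_mul, Complex.conj_I,
    map_one]
  linear_combination ((conj F') / 2) * Complex.I_mul_I

/-- `∂̄ (Im w) = i/2` (for `Im` as a complex-valued function). [folklore] -/
theorem wirtingerDzbar_im (w : ℂ) : wirtingerDzbar (fun z : ℂ => ((z.im : ℝ) : ℂ)) w = Complex.I / 2 := by
  have h : HasFDerivAt (fun z : ℂ => ((z.im : ℝ) : ℂ)) (Complex.ofRealCLM.comp Complex.imCLM) w :=
    (Complex.ofRealCLM.comp Complex.imCLM).hasFDerivAt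
  simp only [wirtingerDzbar, h.fderiv]
  simp

/-- `∂ (Im w) = -i/2`. [folklore] -/
theorem wirtingerDz_im (w : ℂ) : wirtingerDz (fun z : ℂ => ((z.im : ℝ) : ℂ)) w = -Complex.I / 2 := by
  have h : HasFDerivAt (fun z : ℂ => ((z.im : ℝ) : ℂ)) (Complex.ofRealCLM.comp Complex.imCLM) w :=
    (Complex.ofRealCLM.comp Complex.imCLM).hasFDerivAt
  simp only [wirtingerDz, h.fderiv]
  simp

end WirtingerCalculus

section RatioKernelDerivatives

variable {s z₀ η : ℂ}

/-- Real-differentiability of the complexified Poisson kernel in `w` (off `η`, `η̄`). [folklore] -/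
theorem differentiableAt_poissonKernelC {η w : ℂ} (hηw : η ≠ w) (hηw' : η ≠ conj w) :
    DifferentiableAt ℝ (poissonKernelC η) w := by
  unfold poissonKernelC
  have him : DifferentiableAt ℝ (fun z : ℂ => ((z.im : ℝ) : ℂ)) w :=
    (Complex.ofRealCLM.comp Complex.imCLM).differentiableAt
  have hconj : DifferentiableAt ℝ (fun z : ℂ => conj z) w := Complex.conjCLE.differentiableAt
  have hden : DifferentiableAt ℝ (fun z : ℂ => (η - z) * (η - conj z)) w :=
    ((differentiableAt_const η).sub differentiableAt_id).mul ((differentiableAt_const η).sub hconj)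
  simp only [div_eq_mul_inv]
  exact him.mul (hden.inv (mul_ne_zero (sub_ne_zero.mpr hηw) (sub_ne_zero.mpr hηw')))

/-- **`∂̄` of the complexified Poisson kernel**: `∂̄_w R_η(w) = R_η(w) · i (η - w)/(2 Im w (η - w̄))`
(holomorphic factor `(η-w)⁻¹` contributes nothing; `Im w` contributes `i/2`, `(η - w̄)⁻¹`
contributes `(η - w̄)⁻²`; and `i(η - w̄) + 2 Im w = i(η - w)`).
[cite: BruggemanLewisZagier2015, (1.7) p. 10] -/
theorem wirtingerDzbar_poissonKernelC {η w : ℂ} (hw : w.im ≠ 0) (hηw : η ≠ w) (hηw' : η ≠ conj w) :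
    wirtingerDzbar (poissonKernelC η) w =
      poissonKernelC η w * (Complex.I * (η - w) / (2 * ((w.im : ℝ) : ℂ) * (η - conj w))) := by
  have ha : η - w ≠ 0 := sub_ne_zero.mpr hηw
  have hb : η - conj w ≠ 0 := sub_ne_zero.mpr hηw'
  have hb' : conj η - w ≠ 0 := by
    intro h; apply hb; have := congrArg conj h; simpa using this
  -- `R_η = P * (F * G)` with `P = Im`, `F = (η - ·)⁻¹`, `G = conj ∘ (η̄ - ·)⁻¹`
  set P : ℂ → ℂ := fun z => ((z.im : ℝ) : ℂ) with hP
  set F : ℂ → ℂ := fun z => (η - z)⁻¹ with hF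
  set Gt : ℂ → ℂ := fun z => (conj η - z)⁻¹ with hGt
  set G : ℂ → ℂ := fun z => conj (Gt z) with hG
  have hR : poissonKernelC η = P * (F * G) := by
    funext z
    simp only [poissonKernelC, Pi.mul_apply, hP, hF, hG, hGt, map_inv₀, map_sub, Complex.conj_conj]
    rw [div_eq_mul_inv, mul_inv]
  have hFd : HasDerivAt F ((η - w) ^ 2)⁻¹ w := by
    have h := (hasDerivAt_inv ha).comp w ((hasDerivAt_id w).const_sub η)
    have e : -((η - w) ^ 2)⁻¹ * -1 = ((η - w) ^ 2)⁻¹ := by ring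
    rw [e] at h
    exact h
  have hGtd : HasDerivAt Gt ((conj η - w) ^ 2)⁻¹ w := by
    have h := (hasDerivAt_inv hb').comp w ((hasDerivAt_id w).const_sub (conj η))
    have e : -((conj η - w) ^ 2)⁻¹ * -1 = ((conj η - w) ^ 2)⁻¹ := by ring
    rw [e] at h
    exact h
  have hPd : DifferentiableAt ℝ P w := (Complex.ofRealCLM.comp Complex.imCLM).differentiableAt
  have hFd' : DifferentiableAt ℝ F w := hFd.differentiableAt.restrictScalars ℝ
  have hGd' : DifferentiableAt ℝ G w := by
    simp only [hG]
    exact (Complex.conjCLE.differentiableAt).comp w (hGtd.differentiableAt.restrictScalars ℝ)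
  rw [hR, wirtingerDzbar_mul hPd (hFd'.mul hGd'), wirtingerDzbar_mul hFd' hGd',
    wirtingerDzbar_of_hasDerivAt hFd, wirtingerDzbar_im,
    show G = (fun z => conj (Gt z)) from rfl, wirtingerDzbar_conj_of_hasDerivAt hGtd]
  simp only [Pi.mul_apply, hP, hF, hGt, map_inv₀, map_pow, map_sub, Complex.conj_conj]
  have hy : ((w.im : ℝ) : ℂ) ≠ 0 := by exact_mod_cast hw
  field_simp
  have e : ((w.im : ℝ) : ℂ) = (w - conj w) / (2 * Complex.I) := by
    rw [Complex.sub_conj]; field_simp; push_cast; ring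
  rw [e]
  field_simp
  ring_nf
  simp only [Complex.I_sq]
  ring

/-- **`∂̄` of the ratio kernel** ((4.24) of the companion paper: the `dz̄'`-coefficient of
`[u, (R_ζ/R_ζ(z))^s]` is `(is/2y') u (ζ - z')/(ζ - z̄')` times the ratio power):
`∂̄_w (R_η(w)/R_η(z₀))^s = s (R_η(w)/R_η(z₀))^s · i (η - w)/(2 Im w (η - w̄))` at good points.
[cite: BruggemanLewisZagier2015, (1.7) p. 10] -/
theorem wirtingerDzbar_ratioKernel (s : ℂ) {z₀ η w : ℂ} (hw : 0 < w.im) (hηw : η ≠ w)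
    (hηw' : η ≠ conj w) (hz₀ : poissonKernelC η z₀ ≠ 0)
    (hbase : poissonKernelC η w / poissonKernelC η z₀ ∈ Complex.slitPlane) :
    wirtingerDzbar (ratioKernel s z₀ η) w =
      ratioKernel s z₀ η w * (s * Complex.I * (η - w) / (2 * ((w.im : ℝ) : ℂ) * (η - conj w))) := by
  set base : ℂ → ℂ := fun z => poissonKernelC η z / poissonKernelC η z₀ with hbase_def
  have hbd : DifferentiableAt ℝ base w := by
    show DifferentiableAt ℝ (fun z => poissonKernelC η z / poissonKernelC η z₀) w
    simp only [div_eq_mul_inv]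
    exact (differentiableAt_poissonKernelC hηw hηw').mul_const _
  have hb0 : base w ≠ 0 := Complex.slitPlane_ne_zero hbase
  have hout : HasDerivAt (fun q : ℂ => q ^ s) (s * base w ^ (s - 1)) (base w) :=
    (Complex.hasStrictDerivAt_cpow_const hbase).hasDerivAt
  have hcomp : ratioKernel s z₀ η = (fun q : ℂ => q ^ s) ∘ base := rfl
  rw [hcomp, wirtingerDzbar_comp_outer hout hbd]
  have hbbar : wirtingerDzbar base w = wirtingerDzbar (poissonKernelC η) w / poissonKernelC η z₀ := by
    simp only [hbase_def, wirtingerDzbar, div_eq_mul_inv]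
    rw [show (fun z => poissonKernelC η z * (poissonKernelC η z₀)⁻¹) =
        (poissonKernelC η z₀)⁻¹ • poissonKernelC η from by funext z; simp [mul_comm],
      fderiv_const_smul_field]
    simp only [Pi.smul_apply, smul_apply, smul_eq_mul]
    ring
  rw [hbbar, wirtingerDzbar_poissonKernelC hw.ne' hηw hηw']
  simp only [Function.comp_apply]
  have hy : ((w.im : ℝ) : ℂ) ≠ 0 := by exact_mod_cast hw.ne'
  have hb : η - conj w ≠ 0 := sub_ne_zero.mpr hηw'
  have e : base w ^ s = base w ^ (s - 1) * base w := by
    rw [Complex.cpow_sub _ _ hb0, Complex.cpow_one]; field_simp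
  rw [e]
  simp only [hbase_def]
  field_simp

end RatioKernelDerivatives

/-! ## 10. The canonical integrand along the segment `[z₀, η]`: extraction of the endpoint
singularity `(1 - τ)^{-s}` (companion paper, proof of Thm 4.2: "The factor in front is `1`
for `z' = z` and `O((ζ - z')^{-s})` for `z'` near `ζ`") -/

section SegmentAnalysis

variable {s z₀ η : ℂ}

/-- `(x / r)^c = x^c · r^{-c}` for a positive real `r` (no branch is crossed). [folklore] -/
theorem div_ofReal_cpow {r : ℝ} (hr : 0 < r) (x c : ℂ) :
    (x / (r : ℂ)) ^ c = x ^ c * (r : ℂ) ^ (-c) := by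
  rcases eq_or_ne x 0 with rfl | hx
  · rcases eq_or_ne c 0 with rfl | hc
    · simp
    · rw [zero_div, Complex.zero_cpow hc, zero_mul]
  have hr0 : (r : ℂ) ≠ 0 := by exact_mod_cast hr.ne'
  rw [Complex.cpow_def_of_ne_zero (div_ne_zero hx hr0), Complex.cpow_def_of_ne_zero hr0,
    Complex.cpow_def_of_ne_zero hx, ← Complex.exp_add]
  congr 1
  rw [div_eq_mul_inv, ← Complex.ofReal_inv, mul_comm x, Complex.log_ofReal_mul (inv_pos.mpr hr) hx,
    Real.log_inv, Complex.ofReal_neg, Complex.ofReal_log hr.le]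
  ring

/-- **The ratio kernel along the segment**: for `τ ∈ [0, 1)`,
`(R_η(z_τ)/R_η(z₀))^s = (1 - τ)^{-s} · W(τ)^s` with
`W(τ) = (Im z_τ / Im z₀) (η - z̄₀)/(η - z̄_τ)`, `Re W(τ) > 0` (so the principal power of `W` is
smooth up to and including `τ = 1`). [cite: BruggemanLewisZagier2015, (1.7) p. 10] -/
theorem ratioKernel_segment (s : ℂ) {z₀ η : ℂ} (hz₀ : 0 < z₀.im) (hη : 0 < η.im) (hne : η ≠ z₀)
    {τ : ℝ} (hτ : τ ∈ Ico (0 : ℝ) 1) :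
    ratioKernel s z₀ η ((1 - (τ : ℂ)) * z₀ + (τ : ℂ) * η) =
      ((1 - τ : ℝ) : ℂ) ^ (-s) *
        (((((1 - (τ : ℂ)) * z₀ + (τ : ℂ) * η).im / z₀.im : ℝ) : ℂ) *
          ((η - conj z₀) / (η - conj ((1 - (τ : ℂ)) * z₀ + (τ : ℂ) * η)))) ^ s := by
  obtain ⟨W, -, hW, heq⟩ := ratioBase_segment hz₀ hη hne hτ
  have hτ1 : 0 < 1 - τ := by linarith [hτ.2]
  unfold ratioKernel
  rw [heq, ← hW, show (((1 - τ)⁻¹ : ℝ) : ℂ) * W = W / ((1 - τ : ℝ) : ℂ) from by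
    rw [Complex.ofReal_inv]; field_simp, div_ofReal_cpow hτ1, mul_comm]

/-- **The canonical integrand along the segment, with the singularity extracted**: for
`τ ∈ [0,1)` and `U` real-differentiable at `z_τ = (1-τ) z₀ + τ η`,
`[U, (R_η/R_η(z₀))^s](z_τ)(η - z₀) = (1 - τ)^{-s} · g(τ)` with
`g(τ) = W^s · (U_z(z_τ)(η - z₀) + (1-τ) U(z_τ) · s i (η - z₀) conj(η - z₀)/(2 Im z_τ (η - z̄_τ)))`
— the `dz̄'`-part carries the extra factor `ζ - z' = (1-τ)(η - z₀)` of (4.24) of the companion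
paper. [cite: BruggemanLewisZagier2015, (1.7) p. 10] -/
theorem greenForm_ratioKernel_segment (s : ℂ) {U : ℂ → ℂ} {z₀ η : ℂ} (hz₀ : 0 < z₀.im)
    (hη : 0 < η.im) (hne : η ≠ z₀) {τ : ℝ} (hτ : τ ∈ Ico (0 : ℝ) 1) :
    greenForm U (ratioKernel s z₀ η) ((1 - (τ : ℂ)) * z₀ + (τ : ℂ) * η) (η - z₀) =
      ((1 - τ : ℝ) : ℂ) ^ (-s) *
        ((((((1 - (τ : ℂ)) * z₀ + (τ : ℂ) * η).im / z₀.im : ℝ) : ℂ) *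
            ((η - conj z₀) / (η - conj ((1 - (τ : ℂ)) * z₀ + (τ : ℂ) * η)))) ^ s *
          (wirtingerDz U ((1 - (τ : ℂ)) * z₀ + (τ : ℂ) * η) * (η - z₀) +
            ((1 - τ : ℝ) : ℂ) * U ((1 - (τ : ℂ)) * z₀ + (τ : ℂ) * η) *
              (s * Complex.I * (η - z₀) * conj (η - z₀) /
                (2 * (((((1 - (τ : ℂ)) * z₀ + (τ : ℂ) * η).im : ℝ)) : ℂ) *
                  (η - conj ((1 - (τ : ℂ)) * z₀ + (τ : ℂ) * η)))))) := by
  set z' : ℂ := (1 - (τ : ℂ)) * z₀ + (τ : ℂ) * η with hz'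
  obtain ⟨hslit, hηz', hηz'c, hy'⟩ := ratioBase_segment_mem_slitPlane hz₀ hη hne hτ
  rw [← hz'] at hslit hηz' hηz'c hy'
  have hz₀ne : poissonKernelC η z₀ ≠ 0 := by
    refine poissonKernelC_ne_zero hz₀ hne ?_
    intro h; have := congrArg Complex.im h; simp at this; linarith
  have hηz'' : η ≠ conj z' := by
    intro h; have := congrArg Complex.im h; simp at this; linarith
  have hτ1 : 0 < 1 - τ := by linarith [hτ.2]
  rw [greenForm, wirtingerDzbar_ratioKernel s hy' hηz' hηz'' hz₀ne hslit,
    ratioKernel_segment s hz₀ hη hne hτ]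
  rw [← hz', show η - z' = (1 - (τ : ℂ)) * (η - z₀) from by rw [hz', segment_sub_eq]]
  push_cast
  ring

end SegmentAnalysis

section SegmentIntegrability

variable {s z₀ η : ℂ} {U : ℂ → ℂ}

/-- Points of the segment `[z₀, η] ⊂ ℍ` have imaginary part at least `min (Im z₀) (Im η)`.
[folklore] -/
theorem segment_im_ge {z₀ η : ℂ} {τ : ℝ} (hτ : τ ∈ Icc (0 : ℝ) 1) :
    min z₀.im η.im ≤ ((1 - (τ : ℂ)) * z₀ + (τ : ℂ) * η).im := by
  simp only [Complex.add_im, Complex.mul_im, Complex.sub_re, Complex.one_re, Complex.ofReal_re,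
    Complex.sub_im, Complex.one_im, Complex.ofReal_im, sub_zero, zero_mul, add_zero]
  have h0 : 0 ≤ τ := hτ.1
  have h1 : 0 ≤ 1 - τ := by linarith [hτ.2]
  nlinarith [min_le_left z₀.im η.im, min_le_right z₀.im η.im, mul_nonneg h1 (le_refl (0:ℝ))]

/-- The segment map `τ ↦ (1 - τ) z₀ + τ η` is continuous. [folklore] -/
theorem continuous_segmentMap (z₀ η : ℂ) :
    Continuous fun τ : ℝ => (1 - (τ : ℂ)) * z₀ + (τ : ℂ) * η := by fun_prop

/-- The factor `W(τ) = (Im z_τ/Im z₀)(η - z̄₀)/(η - z̄_τ)` has positive real part on `[0, 1]`.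
[folklore] -/
theorem re_segmentW_pos {z₀ η : ℂ} (hz₀ : 0 < z₀.im) (hη : 0 < η.im) {τ : ℝ}
    (hτ : τ ∈ Icc (0 : ℝ) 1) :
    0 < (((((1 - (τ : ℂ)) * z₀ + (τ : ℂ) * η).im / z₀.im : ℝ) : ℂ) *
      ((η - conj z₀) / (η - conj ((1 - (τ : ℂ)) * z₀ + (τ : ℂ) * η)))).re := by
  set z' : ℂ := (1 - (τ : ℂ)) * z₀ + (τ : ℂ) * η with hz'
  have hy' : 0 < z'.im := lt_of_lt_of_le (lt_min hz₀ hη) (segment_im_ge hτ)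
  have hq0 : η - conj z₀ ≠ 0 := by
    intro h; have := congrArg Complex.im h; simp at this; linarith
  have hq'0 : η - conj z' ≠ 0 := by
    intro h; have := congrArg Complex.im h; simp at this; linarith
  have hratio := re_segment_ratio_pos hz₀ hη hτ
  rw [← hz'] at hratio
  rw [Complex.re_ofReal_mul]
  apply mul_pos (div_pos hy' hz₀)
  have hinv : (η - conj z₀) / (η - conj z') = ((η - conj z') / (η - conj z₀))⁻¹ := by
    rw [inv_div]
  rw [hinv, Complex.inv_re]
  exact div_pos hratio (Complex.normSq_pos.mpr (div_ne_zero hq'0 hq0))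

/-- Continuity on `[0, 1]` of `τ ↦ W(τ)^s` (principal power of a function with positive real
part). [folklore] -/
theorem continuousOn_segmentW_cpow (s : ℂ) {z₀ η : ℂ} (hz₀ : 0 < z₀.im) (hη : 0 < η.im) :
    ContinuousOn (fun τ : ℝ => (((((1 - (τ : ℂ)) * z₀ + (τ : ℂ) * η).im / z₀.im : ℝ) : ℂ) *
      ((η - conj z₀) / (η - conj ((1 - (τ : ℂ)) * z₀ + (τ : ℂ) * η)))) ^ s) (Icc 0 1) := by
  apply ContinuousOn.cpow_const
  · apply ContinuousOn.mul
    · exact Complex.continuous_ofReal.comp_continuousOn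
        ((Complex.continuous_im.comp (continuous_segmentMap z₀ η)).continuousOn.div_const _)
    · apply ContinuousOn.div continuousOn_const
      · exact (continuous_const.sub (Complex.continuous_conj.comp
          (continuous_segmentMap z₀ η))).continuousOn
      · intro τ hτ h
        have := congrArg Complex.im h
        simp at this
        nlinarith [mul_nonneg (sub_nonneg.2 hτ.2) hz₀.le, mul_nonneg hτ.1 hη.le, hη]
  · intro τ hτ
    rw [Complex.mem_slitPlane_iff]
    exact Or.inl (re_segmentW_pos hz₀ hη hτ)

/-- `∂/∂z` of a `C²` function is continuous on the open set. [folklore] -/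
theorem continuousOn_wirtingerDz {O : Set ℂ} (hO : IsOpen O) (hU : ContDiffOn ℝ 2 U O) :
    ContinuousOn (fun w => wirtingerDz U w) O := by
  have hDU : ContinuousOn (fderiv ℝ U) O := hU.continuousOn_fderiv_of_isOpen hO (by norm_num)
  unfold wirtingerDz
  exact ((hDU.clm_apply continuousOn_const).sub
    (continuousOn_const.mul (hDU.clm_apply continuousOn_const))).div_const _

/-- **Continuity of the regular part** `g` of the canonical integrand on the closed parameter
interval `[0, 1]` (for `U` of class `C²` on `ℍ`). [folklore] -/
theorem continuousOn_segmentRegularPart (s : ℂ) {U : ℂ → ℂ} (hU : ContDiffOn ℝ 2 U {z : ℂ | 0 < z.im})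
    {z₀ η : ℂ} (hz₀ : 0 < z₀.im) (hη : 0 < η.im) :
    ContinuousOn (fun τ : ℝ =>
      (((((1 - (τ : ℂ)) * z₀ + (τ : ℂ) * η).im / z₀.im : ℝ) : ℂ) *
          ((η - conj z₀) / (η - conj ((1 - (τ : ℂ)) * z₀ + (τ : ℂ) * η)))) ^ s *
        (wirtingerDz U ((1 - (τ : ℂ)) * z₀ + (τ : ℂ) * η) * (η - z₀) +
          ((1 - τ : ℝ) : ℂ) * U ((1 - (τ : ℂ)) * z₀ + (τ : ℂ) * η) *
            (s * Complex.I * (η - z₀) * conj (η - z₀) /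
              (2 * (((((1 - (τ : ℂ)) * z₀ + (τ : ℂ) * η).im : ℝ)) : ℂ) *
                (η - conj ((1 - (τ : ℂ)) * z₀ + (τ : ℂ) * η)))))) (Icc 0 1) := by
  have hO : IsOpen {z : ℂ | 0 < z.im} := isOpen_upperHalfPlaneSet
  have hmaps : MapsTo (fun τ : ℝ => (1 - (τ : ℂ)) * z₀ + (τ : ℂ) * η) (Icc 0 1)
      {z : ℂ | 0 < z.im} := fun τ hτ => lt_of_lt_of_le (lt_min hz₀ hη) (segment_im_ge hτ)
  have hℓ : ContinuousOn (fun τ : ℝ => (1 - (τ : ℂ)) * z₀ + (τ : ℂ) * η) (Icc 0 1) :=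
    (continuous_segmentMap z₀ η).continuousOn
  have hUℓ : ContinuousOn (fun τ : ℝ => U ((1 - (τ : ℂ)) * z₀ + (τ : ℂ) * η)) (Icc 0 1) :=
    hU.continuousOn.comp hℓ hmaps
  have hDzℓ : ContinuousOn (fun τ : ℝ => wirtingerDz U ((1 - (τ : ℂ)) * z₀ + (τ : ℂ) * η))
      (Icc 0 1) := (continuousOn_wirtingerDz hO hU).comp hℓ hmaps
  refine (continuousOn_segmentW_cpow s hz₀ hη).mul ((hDzℓ.mul continuousOn_const).add ?_)
  refine ((Complex.continuous_ofReal.comp (continuous_const.sub continuous_id)).continuousOn.mul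
    hUℓ).mul ?_
  apply ContinuousOn.div continuousOn_const
  · refine (continuousOn_const.mul (Complex.continuous_ofReal.comp_continuousOn
      (Complex.continuous_im.comp (continuous_segmentMap z₀ η)).continuousOn)).mul ?_
    exact (continuous_const.sub (Complex.continuous_conj.comp
      (continuous_segmentMap z₀ η))).continuousOn
  · intro τ hτ
    have hy' : 0 < ((1 - (τ : ℂ)) * z₀ + (τ : ℂ) * η).im :=
      lt_of_lt_of_le (lt_min hz₀ hη) (segment_im_ge hτ)
    refine mul_ne_zero (mul_ne_zero two_ne_zero (by exact_mod_cast hy'.ne')) ?_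
    intro h
    have := congrArg Complex.im h
    simp at this
    nlinarith [mul_nonneg (sub_nonneg.2 hτ.2) hz₀.le, mul_nonneg hτ.1 hη.le, hη]

/-- Integrability on `[0, 1]` of `τ ↦ (1 - τ)^{-s}` for `Re s < 1`. [folklore] -/
theorem intervalIntegrable_one_sub_cpow {s : ℂ} (hs : s.re < 1) :
    IntervalIntegrable (fun τ : ℝ => ((1 - τ : ℝ) : ℂ) ^ (-s)) volume 0 1 := by
  have h := (intervalIntegral.intervalIntegrable_cpow' (a := 0) (b := 1) (r := -s)
    (by simp; linarith)).comp_sub_left 1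
  simp only [sub_zero, sub_self] at h
  exact h.symm

/-- **Integrability of the canonical integrand** `τ ↦ [U, (R_η/R_η(z₀))^s](z_τ)(η - z₀)` on
`[0, 1]` for `Re s < 1` (the singularity at the endpoint `η` is `O((1-τ)^{-Re s})`,
"so the integral for `ζ ∈ ℍ ∖ {z}` converges" — companion paper, proof of Thm 4.2).
[cite: BruggemanLewisZagier2015, (1.7) p. 10] -/
theorem intervalIntegrable_greenForm_ratioKernel (hs : s.re < 1) {U : ℂ → ℂ}
    (hU : ContDiffOn ℝ 2 U {z : ℂ | 0 < z.im}) {z₀ η : ℂ} (hz₀ : 0 < z₀.im) (hη : 0 < η.im)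
    (hne : η ≠ z₀) :
    IntervalIntegrable (fun τ : ℝ =>
      greenForm U (ratioKernel s z₀ η) ((1 - (τ : ℂ)) * z₀ + (τ : ℂ) * η) (η - z₀)) volume 0 1 := by
  have hg := continuousOn_segmentRegularPart s hU hz₀ hη
  have hp := intervalIntegrable_one_sub_cpow hs
  have hprod := hp.mul_continuousOn (by rw [uIcc_of_le (zero_le_one : (0:ℝ) ≤ 1)]; exact hg)
  refine hprod.congr_uIoo ?_
  intro τ hτ
  rw [uIoo_of_le (zero_le_one : (0:ℝ) ≤ 1)] at hτ
  exact (greenForm_ratioKernel_segment s (U := U) hz₀ hη hne ⟨hτ.1.le, hτ.2⟩).symm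

end SegmentIntegrability

/-! ## 11. Truncated segment integrals and differentiation under the integral sign

Tools for the holomorphy of the canonical representative `η ↦ ∫_{z₀}^{η} [u, (R_η/R_η(z₀))^s]`
(companion paper, proof of Thm 4.2: "a contribution to `∂_ζ̄ h` could only come from the upper
limit of integration, but in fact vanishes"): the truncated integral `∫_0^{c}` is the segment
integral to `z₀ + c(η - z₀)`, and integrals `∫ p(τ) G(τ, η) dτ` with a jointly `C¹` regular part
`G` and an integrable weight `p` are differentiated under the integral sign. -/

section Truncation

variable {U V : ℂ → ℂ}

/-- The Green's form is `ℝ`-homogeneous in the tangent vector. [folklore] -/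
theorem greenForm_ofReal_mul (U V : ℂ → ℂ) (w h : ℂ) (c : ℝ) :
    greenForm U V w ((c : ℂ) * h) = (c : ℂ) * greenForm U V w h := by
  simp only [greenForm, map_mul, Complex.conj_ofReal]
  ring

/-- **Truncated segment integrals are segment integrals**: for `0 ≤ c`,
`∫_0^c [U, V]((1-τ) a + τ b)(b - a) dτ = ∫_a^{a_c} [U, V]` with `a_c = (1 - c) a + c b`.
[folklore] -/
theorem integral_greenForm_truncate (U V : ℂ → ℂ) (a b : ℂ) (c : ℝ) :
    ∫ τ in (0 : ℝ)..c, greenForm U V ((1 - (τ : ℂ)) * a + (τ : ℂ) * b) (b - a) =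
      greenSegmentIntegral U V a ((1 - (c : ℂ)) * a + (c : ℂ) * b) := by
  unfold greenSegmentIntegral
  have hpt : ∀ σ : ℝ, (1 - (σ : ℂ)) * a + (σ : ℂ) * ((1 - (c : ℂ)) * a + (c : ℂ) * b) =
      (1 - ((c * σ : ℝ) : ℂ)) * a + ((c * σ : ℝ) : ℂ) * b := fun σ => by push_cast; ring
  have htan : (1 - (c : ℂ)) * a + (c : ℂ) * b - a = (c : ℂ) * (b - a) := by ring
  simp_rw [hpt, htan, greenForm_ofReal_mul]
  rw [intervalIntegral.integral_const_mul]
  rcases eq_or_ne c 0 with rfl | hc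
  · simp
  · rw [intervalIntegral.integral_comp_mul_left
      (f := fun τ : ℝ => greenForm U V ((1 - (τ : ℂ)) * a + (τ : ℂ) * b) (b - a)) hc,
      Complex.real_smul, mul_zero, mul_one]
    have hc' : (c : ℂ) ≠ 0 := by exact_mod_cast hc
    have e1 : (c : ℂ) * ((c⁻¹ : ℝ) : ℂ) = 1 := by
      rw [Complex.ofReal_inv]; field_simp
    rw [← mul_assoc, e1, one_mul]

end Truncation

section DominatedDifferentiation

/-- **Differentiation under the integral sign with a singular weight.** Let `G : ℝ × ℂ → ℂ` be
`C¹` on an open set `Ω` containing `[a, b] × {η₀}` and let `p` be interval integrable on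
`[a, b]`. Then there are `r > 0` and `M` such that `[a, b] × B̄(η₀, r) ⊆ Ω`,
`‖DG‖ ≤ M` there, and for every subinterval `[a', b'] ⊆ [a, b]` the function
`η ↦ ∫_{a'}^{b'} p(τ) G(τ, η) dτ` has at `η₀` the Fréchet derivative
`∫_{a'}^{b'} p(τ) • ∂_η G(τ, η₀) dτ`, of norm at most `M ∫_{a'}^{b'} ‖p‖`. [folklore] -/
theorem hasFDerivAt_integral_mul_of_contDiffOn {G : ℝ × ℂ → ℂ} {Ω : Set (ℝ × ℂ)}
    (hΩ : IsOpen Ω) (hG : ContDiffOn ℝ 1 G Ω) {a b : ℝ} (hab : a ≤ b) {η₀ : ℂ}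
    (hK : Icc a b ×ˢ ({η₀} : Set ℂ) ⊆ Ω) {p : ℝ → ℂ} (hp : IntervalIntegrable p volume a b) :
    ∃ r > 0, ∃ M : ℝ, 0 ≤ M ∧ (Icc a b ×ˢ Metric.closedBall η₀ r ⊆ Ω) ∧
      (∀ x ∈ Icc a b ×ˢ Metric.closedBall η₀ r, ‖fderiv ℝ G x‖ ≤ M) ∧
      ∀ a' b' : ℝ, a ≤ a' → a' ≤ b' → b' ≤ b →
        HasFDerivAt (fun η : ℂ => ∫ τ in a'..b', p τ * G (τ, η))
          (∫ τ in a'..b', p τ • (fderiv ℝ G (τ, η₀)).comp (ContinuousLinearMap.inr ℝ ℝ ℂ)) η₀ ∧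
        ‖∫ τ in a'..b', p τ • (fderiv ℝ G (τ, η₀)).comp (ContinuousLinearMap.inr ℝ ℝ ℂ)‖ ≤
          M * ∫ τ in a'..b', ‖p τ‖ := by
  -- a closed tube around `[a,b] × {η₀}` inside `Ω`
  obtain ⟨δ, hδ, hδΩ⟩ := (isCompact_Icc.prod isCompact_singleton).exists_thickening_subset_open hΩ hK
  set r : ℝ := δ / 2 with hr
  have hr0 : 0 < r := by positivity
  have htube : Icc a b ×ˢ Metric.closedBall η₀ r ⊆ Ω := by
    intro x hx
    apply hδΩ
    rw [Metric.mem_thickening_iff]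
    refine ⟨(x.1, η₀), ⟨hx.1, rfl⟩, ?_⟩
    rw [Prod.dist_eq, dist_self]
    have : dist x.2 η₀ ≤ r := hx.2
    rw [max_eq_right dist_nonneg]
    linarith
  -- a bound for `DG` on the tube
  have hKc : IsCompact (Icc a b ×ˢ Metric.closedBall η₀ r) :=
    isCompact_Icc.prod (isCompact_closedBall _ _)
  have hDGc : ContinuousOn (fderiv ℝ G) Ω := hG.continuousOn_fderiv_of_isOpen hΩ le_rfl
  obtain ⟨M₀, hM₀⟩ := hKc.exists_bound_of_continuousOn (hDGc.mono htube)
  set M : ℝ := max M₀ 0 with hM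
  have hMnn : 0 ≤ M := le_max_right _ _
  have hMb : ∀ x ∈ Icc a b ×ˢ Metric.closedBall η₀ r, ‖fderiv ℝ G x‖ ≤ M := fun x hx =>
    (hM₀ x hx).trans (le_max_left _ _)
  refine ⟨r, hr0, M, hMnn, htube, hMb, fun a' b' haa' ha'b' hb'b => ?_⟩
  have hsub : Icc a' b' ⊆ Icc a b := Icc_subset_Icc haa' hb'b
  -- continuity of `G` and `DG` along horizontal slices
  have hslice : ∀ η ∈ Metric.closedBall η₀ r, ContinuousOn (fun τ : ℝ => G (τ, η)) (Icc a b) := by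
    intro η hη
    refine hG.continuousOn.comp (by fun_prop) fun τ hτ => htube ⟨hτ, hη⟩
  have hslice' : ContinuousOn (fun τ : ℝ => (fderiv ℝ G (τ, η₀)).comp
      (ContinuousLinearMap.inr ℝ ℝ ℂ)) (Icc a b) := by
    have h1 : ContinuousOn (fun τ : ℝ => fderiv ℝ G (τ, η₀)) (Icc a b) :=
      hDGc.comp (by fun_prop) fun τ hτ => htube ⟨hτ, Metric.mem_closedBall_self hr0.le⟩
    exact ((ContinuousLinearMap.compL ℝ ℂ (ℝ × ℂ) ℂ).flip (ContinuousLinearMap.inr ℝ ℝ ℂ)).continuous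
      |>.comp_continuousOn h1
  -- the derivative of `η ↦ G(τ, η)`
  have hderiv : ∀ τ ∈ Icc a b, ∀ η ∈ Metric.ball η₀ r,
      HasFDerivAt (fun η : ℂ => p τ * G (τ, η))
        (p τ • (fderiv ℝ G (τ, η)).comp (ContinuousLinearMap.inr ℝ ℝ ℂ)) η := by
    intro τ hτ η hη
    have hx : (τ, η) ∈ Ω := htube ⟨hτ, Metric.ball_subset_closedBall hη⟩
    have hGd : HasFDerivAt G (fderiv ℝ G (τ, η)) (τ, η) :=
      ((hG.differentiableOn one_ne_zero).differentiableAt (hΩ.mem_nhds hx)).hasFDerivAt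
    have hcomp := hGd.comp η (hasFDerivAt_prodMk_right (𝕜 := ℝ) τ η)
    exact hcomp.const_mul (p τ)
  have hp' : IntervalIntegrable p volume a' b' := hp.mono_set (by
    rw [uIcc_of_le hab, uIcc_of_le ha'b']; exact hsub)
  -- dominated differentiation
  have hmain := intervalIntegral.hasFDerivAt_integral_of_dominated_of_fderiv_le
    (μ := volume) (a := a') (b := b') (x₀ := η₀) (s := Metric.ball η₀ r)
    (F := fun (η : ℂ) (τ : ℝ) => p τ * G (τ, η))
    (F' := fun (η : ℂ) (τ : ℝ) => p τ • (fderiv ℝ G (τ, η)).comp (ContinuousLinearMap.inr ℝ ℝ ℂ))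
    (bound := fun τ => ‖p τ‖ * M) (Metric.ball_mem_nhds η₀ hr0) ?_ ?_ ?_ ?_ ?_ ?_
  · refine ⟨hmain, ?_⟩
    calc ‖∫ τ in a'..b', p τ • (fderiv ℝ G (τ, η₀)).comp (ContinuousLinearMap.inr ℝ ℝ ℂ)‖
        ≤ ∫ τ in a'..b', ‖p τ‖ * M := by
          refine intervalIntegral.norm_integral_le_of_norm_le ha'b' ?_ ?_
          · filter_upwards with τ hτ
            have hτ' : τ ∈ Icc a b := hsub (Ioc_subset_Icc_self hτ)
            calc ‖p τ • (fderiv ℝ G (τ, η₀)).comp (ContinuousLinearMap.inr ℝ ℝ ℂ)‖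
                ≤ ‖p τ‖ * ‖(fderiv ℝ G (τ, η₀)).comp (ContinuousLinearMap.inr ℝ ℝ ℂ)‖ :=
                  norm_smul_le _ _
              _ ≤ ‖p τ‖ * M := by
                  gcongr
                  refine (ContinuousLinearMap.opNorm_comp_le _ _).trans ?_
                  calc ‖fderiv ℝ G (τ, η₀)‖ * ‖ContinuousLinearMap.inr ℝ ℝ ℂ‖
                      ≤ M * 1 := by
                        gcongr
                        · exact hMb _ ⟨hτ', Metric.mem_closedBall_self hr0.le⟩
                        · exact ContinuousLinearMap.norm_inr_le_one ℝ ℝ ℂ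
                    _ = M := mul_one M
          · exact (hp'.norm.mul_const M)
      _ = M * ∫ τ in a'..b', ‖p τ‖ := by
          rw [intervalIntegral.integral_mul_const, mul_comm]
  · -- measurability of `F η` near `η₀`
    filter_upwards [Metric.ball_mem_nhds η₀ hr0] with η hη
    refine (hp'.1.aestronglyMeasurable.mono_measure ?_).mul ?_
    · rw [uIoc_of_le ha'b']
    · refine ContinuousOn.aestronglyMeasurable ?_ measurableSet_uIoc
      rw [uIoc_of_le ha'b']
      exact ((hslice η (Metric.ball_subset_closedBall hη)).mono
        (Ioc_subset_Icc_self.trans hsub))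
  · exact hp'.mul_continuousOn (by
      rw [uIcc_of_le ha'b']
      exact (hslice η₀ (Metric.mem_closedBall_self hr0.le)).mono hsub)
  · refine ((hp'.1.aestronglyMeasurable.mono_measure ?_).smul ?_)
    · rw [uIoc_of_le ha'b']
    · refine ContinuousOn.aestronglyMeasurable ?_ measurableSet_uIoc
      rw [uIoc_of_le ha'b']
      exact hslice'.mono (Ioc_subset_Icc_self.trans hsub)
  · filter_upwards with τ hτ η hη
    rw [uIoc_of_le ha'b'] at hτ
    have hτ' : τ ∈ Icc a b := hsub (Ioc_subset_Icc_self hτ)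
    calc ‖p τ • (fderiv ℝ G (τ, η)).comp (ContinuousLinearMap.inr ℝ ℝ ℂ)‖
        ≤ ‖p τ‖ * ‖(fderiv ℝ G (τ, η)).comp (ContinuousLinearMap.inr ℝ ℝ ℂ)‖ := norm_smul_le _ _
      _ ≤ ‖p τ‖ * M := by
          gcongr
          refine (ContinuousLinearMap.opNorm_comp_le _ _).trans ?_
          calc ‖fderiv ℝ G (τ, η)‖ * ‖ContinuousLinearMap.inr ℝ ℝ ℂ‖ ≤ M * 1 := by
                gcongr
                · exact hMb _ ⟨hτ', (Metric.ball_subset_closedBall hη)⟩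
                · exact ContinuousLinearMap.norm_inr_le_one ℝ ℝ ℂ
            _ = M := mul_one M
  · exact hp'.norm.mul_const M
  · filter_upwards with τ hτ η hη
    rw [uIoc_of_le ha'b'] at hτ
    exact hderiv τ (hsub (Ioc_subset_Icc_self hτ)) η hη

end DominatedDifferentiation

/-! ## 12. The regular part of the canonical integrand as a jointly `C¹` function -/

section RegularPart

variable {s z₀ : ℂ} {U : ℂ → ℂ}

/-- The segment map `(τ, η) ↦ (1 - τ) z₀ + τ η` on `ℝ × ℂ` is smooth. [folklore] -/
theorem contDiff_segmentMap₂ (z₀ : ℂ) {n : WithTop ℕ∞} :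
    ContDiff ℝ n (fun x : ℝ × ℂ => (1 - (x.1 : ℂ)) * z₀ + (x.1 : ℂ) * x.2) := by
  have h1 : ContDiff ℝ n (fun x : ℝ × ℂ => ((x.1 : ℝ) : ℂ)) :=
    Complex.ofRealCLM.contDiff.comp contDiff_fst
  exact ((contDiff_const.sub h1).mul contDiff_const).add (h1.mul contDiff_snd)

/-- `(τ, η) ↦ Im((1-τ) z₀ + τ η)` as a complex-valued function is smooth. [folklore] -/
theorem contDiff_im_segmentMap₂ (z₀ : ℂ) {n : WithTop ℕ∞} :
    ContDiff ℝ n (fun x : ℝ × ℂ => ((((1 - (x.1 : ℂ)) * z₀ + (x.1 : ℂ) * x.2).im : ℝ) : ℂ)) :=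
  (Complex.ofRealCLM.contDiff.comp Complex.imCLM.contDiff).comp (contDiff_segmentMap₂ z₀)

/-- `∂/∂z` of a `C²` function is `C¹` on the open set. [folklore] -/
theorem contDiffOn_wirtingerDz {O : Set ℂ} (hO : IsOpen O) (hU : ContDiffOn ℝ 2 U O) :
    ContDiffOn ℝ 1 (fun w => wirtingerDz U w) O := by
  have hDU : ContDiffOn ℝ 1 (fderiv ℝ U) O :=
    hU.fderiv_of_isOpen hO (by norm_num)
  unfold wirtingerDz
  exact ((hDU.clm_apply contDiffOn_const).sub
    (contDiffOn_const.mul (hDU.clm_apply contDiffOn_const))).div_const _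

/-- Quotients of `ℂ`-valued `C^n` functions over `ℝ` (Mathlib's `ContDiffOn.div` wants values in
the scalar field). [folklore] -/
theorem contDiffOn_div_real {E : Type*} [NormedAddCommGroup E] [NormedSpace ℝ E] {f g : E → ℂ}
    {S : Set E} {n : WithTop ℕ∞} (hf : ContDiffOn ℝ n f S) (hg : ContDiffOn ℝ n g S)
    (h0 : ∀ x ∈ S, g x ≠ 0) : ContDiffOn ℝ n (fun x => f x / g x) S :=
  (hf.mul (hg.inv h0)).congr fun _ _ => div_eq_mul_inv _ _

/-- **Joint `C¹`-regularity of the regular part** `G(τ, η)` of the canonical integrand on the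
open set `Ω = {Im η > 0, Im z_τ > 0, W ∈ slit plane}` (for `U` of class `C²` on `ℍ`).
[folklore] -/
theorem contDiffOn_regularPart (s : ℂ) {U : ℂ → ℂ} (hU : ContDiffOn ℝ 2 U {z : ℂ | 0 < z.im})
    (z₀ : ℂ) :
    ContDiffOn ℝ 1 (fun x : ℝ × ℂ =>
      (((((1 - (x.1 : ℂ)) * z₀ + (x.1 : ℂ) * x.2).im / z₀.im : ℝ) : ℂ) *
          ((x.2 - conj z₀) / (x.2 - conj ((1 - (x.1 : ℂ)) * z₀ + (x.1 : ℂ) * x.2)))) ^ s *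
        (wirtingerDz U ((1 - (x.1 : ℂ)) * z₀ + (x.1 : ℂ) * x.2) * (x.2 - z₀) +
          ((1 - x.1 : ℝ) : ℂ) * U ((1 - (x.1 : ℂ)) * z₀ + (x.1 : ℂ) * x.2) *
            (s * Complex.I * (x.2 - z₀) * conj (x.2 - z₀) /
              (2 * (((((1 - (x.1 : ℂ)) * z₀ + (x.1 : ℂ) * x.2).im : ℝ)) : ℂ) *
                (x.2 - conj ((1 - (x.1 : ℂ)) * z₀ + (x.1 : ℂ) * x.2))))))
      {x : ℝ × ℂ | 0 < x.2.im ∧ 0 < ((1 - (x.1 : ℂ)) * z₀ + (x.1 : ℂ) * x.2).im ∧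
        (((((1 - (x.1 : ℂ)) * z₀ + (x.1 : ℂ) * x.2).im / z₀.im : ℝ) : ℂ) *
          ((x.2 - conj z₀) / (x.2 - conj ((1 - (x.1 : ℂ)) * z₀ + (x.1 : ℂ) * x.2)))) ∈
            Complex.slitPlane} := by
  set Ω : Set (ℝ × ℂ) := {x : ℝ × ℂ | 0 < x.2.im ∧ 0 < ((1 - (x.1 : ℂ)) * z₀ + (x.1 : ℂ) * x.2).im ∧
        (((((1 - (x.1 : ℂ)) * z₀ + (x.1 : ℂ) * x.2).im / z₀.im : ℝ) : ℂ) *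
          ((x.2 - conj z₀) / (x.2 - conj ((1 - (x.1 : ℂ)) * z₀ + (x.1 : ℂ) * x.2)))) ∈
            Complex.slitPlane} with hΩ
  have hO : IsOpen {z : ℂ | 0 < z.im} := isOpen_upperHalfPlaneSet
  -- building blocks
  have hℓ : ContDiff ℝ 1 (fun x : ℝ × ℂ => (1 - (x.1 : ℂ)) * z₀ + (x.1 : ℂ) * x.2) :=
    contDiff_segmentMap₂ z₀
  have hsnd : ContDiff ℝ 1 (fun x : ℝ × ℂ => x.2) := contDiff_snd
  have hfstC : ContDiff ℝ 1 (fun x : ℝ × ℂ => ((x.1 : ℝ) : ℂ)) :=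
    Complex.ofRealCLM.contDiff.comp contDiff_fst
  have himC : ContDiff ℝ 1 (fun x : ℝ × ℂ =>
      ((((1 - (x.1 : ℂ)) * z₀ + (x.1 : ℂ) * x.2).im : ℝ) : ℂ)) := contDiff_im_segmentMap₂ z₀
  have himR : ContDiff ℝ 1 (fun x : ℝ × ℂ => ((1 - (x.1 : ℂ)) * z₀ + (x.1 : ℂ) * x.2).im) :=
    Complex.imCLM.contDiff.comp hℓ
  have hconjℓ : ContDiff ℝ 1 (fun x : ℝ × ℂ => conj ((1 - (x.1 : ℂ)) * z₀ + (x.1 : ℂ) * x.2)) :=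
    Complex.conjCLE.contDiff.comp hℓ
  have hden1 : ∀ x ∈ Ω, x.2 - conj ((1 - (x.1 : ℂ)) * z₀ + (x.1 : ℂ) * x.2) ≠ 0 := by
    intro x hx h
    have h1' : 0 < x.2.im := hx.1
    have h2' : 0 < ((1 - (x.1 : ℂ)) * z₀ + (x.1 : ℂ) * x.2).im := hx.2.1
    have := congrArg Complex.im h
    simp only [Complex.sub_im, Complex.conj_im, Complex.zero_im] at this
    linarith
  have hmaps : MapsTo (fun x : ℝ × ℂ => (1 - (x.1 : ℂ)) * z₀ + (x.1 : ℂ) * x.2) Ω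
      {z : ℂ | 0 < z.im} := fun x hx => hx.2.1
  -- `W` and `W^s`
  have hW : ContDiffOn ℝ 1 (fun x : ℝ × ℂ =>
      ((((1 - (x.1 : ℂ)) * z₀ + (x.1 : ℂ) * x.2).im / z₀.im : ℝ) : ℂ) *
        ((x.2 - conj z₀) / (x.2 - conj ((1 - (x.1 : ℂ)) * z₀ + (x.1 : ℂ) * x.2)))) Ω := by
    refine ContDiffOn.mul ?_ ?_
    · have : ContDiff ℝ 1 (fun x : ℝ × ℂ =>
          (((((1 - (x.1 : ℂ)) * z₀ + (x.1 : ℂ) * x.2).im / z₀.im : ℝ)) : ℂ)) :=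
        Complex.ofRealCLM.contDiff.comp (himR.div_const _)
      exact this.contDiffOn
    · exact contDiffOn_div_real (hsnd.sub contDiff_const).contDiffOn (hsnd.sub hconjℓ).contDiffOn hden1
  have hWs : ContDiffOn ℝ 1 (fun x : ℝ × ℂ =>
      (((((1 - (x.1 : ℂ)) * z₀ + (x.1 : ℂ) * x.2).im / z₀.im : ℝ) : ℂ) *
        ((x.2 - conj z₀) / (x.2 - conj ((1 - (x.1 : ℂ)) * z₀ + (x.1 : ℂ) * x.2)))) ^ s) Ω := by
    intro x hx
    have hq : AnalyticAt ℂ (fun q : ℂ => q ^ s)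
        ((((((1 - (x.1 : ℂ)) * z₀ + (x.1 : ℂ) * x.2).im / z₀.im : ℝ) : ℂ) *
          ((x.2 - conj z₀) / (x.2 - conj ((1 - (x.1 : ℂ)) * z₀ + (x.1 : ℂ) * x.2))))) :=
      AnalyticAt.cpow analyticAt_id analyticAt_const hx.2.2
    exact ((hq.contDiffAt (n := 1)).restrict_scalars ℝ).comp_contDiffWithinAt x (hW x hx)
  -- `U ∘ ℓ` and `U_z ∘ ℓ`
  have hUℓ : ContDiffOn ℝ 1 (fun x : ℝ × ℂ => U ((1 - (x.1 : ℂ)) * z₀ + (x.1 : ℂ) * x.2)) Ω :=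
    (hU.of_le (by norm_num)).comp hℓ.contDiffOn hmaps
  have hDzℓ : ContDiffOn ℝ 1 (fun x : ℝ × ℂ =>
      wirtingerDz U ((1 - (x.1 : ℂ)) * z₀ + (x.1 : ℂ) * x.2)) Ω :=
    (contDiffOn_wirtingerDz hO hU).comp hℓ.contDiffOn hmaps
  -- the quotient
  have hden2 : ∀ x ∈ Ω, (2 * (((((1 - (x.1 : ℂ)) * z₀ + (x.1 : ℂ) * x.2).im : ℝ)) : ℂ) *
      (x.2 - conj ((1 - (x.1 : ℂ)) * z₀ + (x.1 : ℂ) * x.2))) ≠ 0 := by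
    intro x hx
    refine mul_ne_zero (mul_ne_zero two_ne_zero ?_) (hden1 x hx)
    exact_mod_cast hx.2.1.ne'
  have hquot : ContDiffOn ℝ 1 (fun x : ℝ × ℂ =>
      s * Complex.I * (x.2 - z₀) * conj (x.2 - z₀) /
        (2 * (((((1 - (x.1 : ℂ)) * z₀ + (x.1 : ℂ) * x.2).im : ℝ)) : ℂ) *
          (x.2 - conj ((1 - (x.1 : ℂ)) * z₀ + (x.1 : ℂ) * x.2)))) Ω := by
    refine contDiffOn_div_real ?_ ?_ hden2
    · exact ((contDiff_const.mul (hsnd.sub contDiff_const)).mul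
        (Complex.conjCLE.contDiff.comp (hsnd.sub contDiff_const))).contDiffOn
    · exact ((contDiff_const.mul himC).mul (hsnd.sub hconjℓ)).contDiffOn
  have h1τ : ContDiff ℝ 1 (fun x : ℝ × ℂ => (((1 - x.1 : ℝ)) : ℂ)) :=
    Complex.ofRealCLM.contDiff.comp (contDiff_const.sub contDiff_fst)
  exact hWs.mul ((hDzℓ.mul (hsnd.sub contDiff_const).contDiffOn).add
    ((h1τ.contDiffOn.mul hUℓ).mul hquot))

/-- The set `Ω` of the previous theorem is open. [folklore] -/
theorem isOpen_regularPartDomain (z₀ : ℂ) :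
    IsOpen {x : ℝ × ℂ | 0 < x.2.im ∧ 0 < ((1 - (x.1 : ℂ)) * z₀ + (x.1 : ℂ) * x.2).im ∧
        (((((1 - (x.1 : ℂ)) * z₀ + (x.1 : ℂ) * x.2).im / z₀.im : ℝ) : ℂ) *
          ((x.2 - conj z₀) / (x.2 - conj ((1 - (x.1 : ℂ)) * z₀ + (x.1 : ℂ) * x.2)))) ∈
            Complex.slitPlane} := by
  have hℓc : Continuous (fun x : ℝ × ℂ => (1 - (x.1 : ℂ)) * z₀ + (x.1 : ℂ) * x.2) :=
    (contDiff_segmentMap₂ z₀ (n := 0)).continuous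
  have h1 : IsOpen {x : ℝ × ℂ | 0 < x.2.im} :=
    isOpen_lt continuous_const (Complex.continuous_im.comp continuous_snd)
  have h2 : IsOpen {x : ℝ × ℂ | 0 < ((1 - (x.1 : ℂ)) * z₀ + (x.1 : ℂ) * x.2).im} :=
    isOpen_lt continuous_const (Complex.continuous_im.comp hℓc)
  -- on the open set `{Im η > 0} ∩ {Im z_τ > 0}` the function `W` is continuous
  have h12 : IsOpen ({x : ℝ × ℂ | 0 < x.2.im} ∩ {x : ℝ × ℂ | 0 < ((1 - (x.1 : ℂ)) * z₀ + (x.1 : ℂ) * x.2).im}) :=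
    h1.inter h2
  have hWc : ContinuousOn (fun x : ℝ × ℂ =>
      ((((1 - (x.1 : ℂ)) * z₀ + (x.1 : ℂ) * x.2).im / z₀.im : ℝ) : ℂ) *
        ((x.2 - conj z₀) / (x.2 - conj ((1 - (x.1 : ℂ)) * z₀ + (x.1 : ℂ) * x.2))))
      ({x : ℝ × ℂ | 0 < x.2.im} ∩ {x : ℝ × ℂ | 0 < ((1 - (x.1 : ℂ)) * z₀ + (x.1 : ℂ) * x.2).im}) := by
    refine ContinuousOn.mul ?_ ?_
    · exact (Complex.continuous_ofReal.comp ((Complex.continuous_im.comp hℓc).div_const _)).continuousOn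
    · refine ContinuousOn.div (by fun_prop) ((continuous_snd.sub
        (Complex.continuous_conj.comp hℓc)).continuousOn) ?_
      intro x hx h
      have h1' : 0 < x.2.im := hx.1
      have h2' : 0 < ((1 - (x.1 : ℂ)) * z₀ + (x.1 : ℂ) * x.2).im := hx.2
      have := congrArg Complex.im h
      simp only [Complex.sub_im, Complex.conj_im, Complex.zero_im] at this
      linarith
  have h3 := hWc.isOpen_inter_preimage h12 Complex.isOpen_slitPlane
  rw [Set.setOf_and, Set.setOf_and, ← Set.inter_assoc]
  exact h3

/-- The compact slice `[0,1] × {η}` lies in `Ω` for `η, z₀ ∈ ℍ`. [folklore] -/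
theorem segmentSlice_subset_regularPartDomain {z₀ η : ℂ} (hz₀ : 0 < z₀.im) (hη : 0 < η.im) :
    Icc (0 : ℝ) 1 ×ˢ ({η} : Set ℂ) ⊆
      {x : ℝ × ℂ | 0 < x.2.im ∧ 0 < ((1 - (x.1 : ℂ)) * z₀ + (x.1 : ℂ) * x.2).im ∧
        (((((1 - (x.1 : ℂ)) * z₀ + (x.1 : ℂ) * x.2).im / z₀.im : ℝ) : ℂ) *
          ((x.2 - conj z₀) / (x.2 - conj ((1 - (x.1 : ℂ)) * z₀ + (x.1 : ℂ) * x.2)))) ∈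
            Complex.slitPlane} := by
  rintro ⟨τ, η'⟩ ⟨hτ, hη'⟩
  have hη'' : η' = η := hη'
  subst hη''
  refine ⟨hη, lt_of_lt_of_le (lt_min hz₀ hη) (segment_im_ge hτ), ?_⟩
  rw [Complex.mem_slitPlane_iff]
  exact Or.inl (re_segmentW_pos hz₀ hη hτ)

end RegularPart

/-! ## 13. The geometric derivative of the truncated canonical integral

For `ε ∈ (0,1)` the truncated integral `I_ε(η) = ∫_{z₀}^{z_ε(η)} [u, (R_η/R_η(z₀))^s]`,
`z_ε(η) = z₀ + (1-ε)(η - z₀)`, splits near `η₀` by path additivity into an integral over the fixed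
segment `[z₀, z_ε(η₀)]` (holomorphic in the kernel parameter `η`) plus an integral over the short
segment `[z_ε(η₀), z_ε(η)]`, whose derivative at `η₀` is the Green's form at `z_ε(η₀)` evaluated on
the tangent `(1-ε)(η - η₀)`; hence the `∂̄`-part of `D I_ε(η₀)` is `(1-ε)` times the
`dz̄`-coefficient `u(z_ε) ∂̄V_{η₀}(z_ε)` of the form (companion paper, proof of Thm 4.2). -/

section UniformGoodNeighbourhood

/-- The pairs `(η, w)` "good" for the ratio kernel: `w, η ∈ ℍ`, `η ≠ w`, `η ≠ z₀`, and the ratio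
base `R_η(w)/R_η(z₀)` off the cut; an open set (for `z₀ ∈ ℍ`). [folklore] -/
theorem isOpen_goodPairs {z₀ : ℂ} (hz₀ : 0 < z₀.im) :
    IsOpen {q : ℂ × ℂ | 0 < q.2.im ∧ 0 < q.1.im ∧ q.1 ≠ q.2 ∧ q.1 ≠ z₀ ∧
      poissonKernelC q.1 q.2 / poissonKernelC q.1 z₀ ∈ Complex.slitPlane} := by
  set S : Set (ℂ × ℂ) := {q : ℂ × ℂ | 0 < q.2.im ∧ 0 < q.1.im ∧ q.1 ≠ q.2 ∧ q.1 ≠ z₀} with hS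
  have hSo : IsOpen S := by
    simp only [hS, Set.setOf_and]
    exact (isOpen_lt continuous_const (Complex.continuous_im.comp continuous_snd)).inter
      ((isOpen_lt continuous_const (Complex.continuous_im.comp continuous_fst)).inter
      ((isOpen_ne_fun continuous_fst continuous_snd).inter
      (isOpen_ne_fun continuous_fst continuous_const)))
  -- auxiliary nonvanishing facts on `S`
  have hne1 : ∀ q ∈ S, (q.1 - q.2) * (q.1 - conj q.2) ≠ 0 := by
    intro q hq
    refine mul_ne_zero (sub_ne_zero.mpr hq.2.2.1) (sub_ne_zero.mpr ?_)
    intro h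
    have h1 : 0 < q.1.im := hq.2.1
    have h2 : 0 < q.2.im := hq.1
    have := congrArg Complex.im h
    simp at this; linarith
  have hne2 : ∀ q ∈ S, (q.1 - z₀) * (q.1 - conj z₀) ≠ 0 := by
    intro q hq
    refine mul_ne_zero (sub_ne_zero.mpr hq.2.2.2) (sub_ne_zero.mpr ?_)
    intro h
    have h1 : 0 < q.1.im := hq.2.1
    have := congrArg Complex.im h
    simp at this; linarith
  have hne3 : ∀ q ∈ S, poissonKernelC q.1 z₀ ≠ 0 := by
    intro q hq
    unfold poissonKernelC
    exact div_ne_zero (by exact_mod_cast hz₀.ne') (hne2 q hq)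
  have hcont : ContinuousOn (fun q : ℂ × ℂ => poissonKernelC q.1 q.2 / poissonKernelC q.1 z₀) S := by
    refine ContinuousOn.div ?_ ?_ hne3
    · simp only [poissonKernelC]
      exact ContinuousOn.div (by fun_prop) (by fun_prop) hne1
    · simp only [poissonKernelC]
      exact ContinuousOn.div (by fun_prop) (by fun_prop) hne2
  have h := hcont.isOpen_inter_preimage hSo Complex.isOpen_slitPlane
  have heq : {q : ℂ × ℂ | 0 < q.2.im ∧ 0 < q.1.im ∧ q.1 ≠ q.2 ∧ q.1 ≠ z₀ ∧
      poissonKernelC q.1 q.2 / poissonKernelC q.1 z₀ ∈ Complex.slitPlane} =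
      S ∩ (fun q : ℂ × ℂ => poissonKernelC q.1 q.2 / poissonKernelC q.1 z₀) ⁻¹' Complex.slitPlane := by
    ext q
    simp only [hS, Set.mem_setOf_eq, Set.mem_inter_iff, Set.mem_preimage]
    tauto
  rw [heq]
  exact h

/-- At a good pair the hypotheses of the kernel lemmas hold. [folklore] -/
theorem goodPair_props {z₀ η w : ℂ} (hz₀ : 0 < z₀.im)
    (h : (η, w) ∈ {q : ℂ × ℂ | 0 < q.2.im ∧ 0 < q.1.im ∧ q.1 ≠ q.2 ∧ q.1 ≠ z₀ ∧
      poissonKernelC q.1 q.2 / poissonKernelC q.1 z₀ ∈ Complex.slitPlane}) :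
    0 < w.im ∧ η ≠ w ∧ conj η ≠ w ∧ η ≠ conj w ∧ poissonKernelC η z₀ ≠ 0 ∧
      poissonKernelC η w / poissonKernelC η z₀ ∈ Complex.slitPlane := by
  obtain ⟨hw, hη, hηw, hηz₀, hslit⟩ := h
  refine ⟨hw, hηw, ?_, ?_, ?_, hslit⟩
  · intro h; have := congrArg Complex.im h; simp at this; linarith
  · intro h; have := congrArg Complex.im h; simp at this; linarith
  · refine poissonKernelC_ne_zero hz₀ hηz₀ ?_
    intro h; have := congrArg Complex.im h; simp at this; linarith

/-- Points of the closed segment `[z₀, z_c]`, `z_c = (1-c) z₀ + c η₀` with `0 ≤ c < 1`, are good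
for the parameter `η₀`. [folklore] -/
theorem segment_truncated_good {z₀ η₀ : ℂ} (hz₀ : 0 < z₀.im) (hη₀ : 0 < η₀.im) (hne : η₀ ≠ z₀)
    {c : ℝ} (hc : c ∈ Ico (0 : ℝ) 1) {w : ℂ}
    (hw : w ∈ segment ℝ z₀ ((1 - (c : ℂ)) * z₀ + (c : ℂ) * η₀)) :
    (η₀, w) ∈ {q : ℂ × ℂ | 0 < q.2.im ∧ 0 < q.1.im ∧ q.1 ≠ q.2 ∧ q.1 ≠ z₀ ∧
      poissonKernelC q.1 q.2 / poissonKernelC q.1 z₀ ∈ Complex.slitPlane} := by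
  rw [segment_eq_image_lineMap] at hw
  obtain ⟨θ, hθ, rfl⟩ := hw
  have hθc : c * θ ∈ Ico (0 : ℝ) 1 := by
    refine ⟨mul_nonneg hc.1 hθ.1, ?_⟩
    calc c * θ ≤ c * 1 := mul_le_mul_of_nonneg_left hθ.2 hc.1
      _ < 1 := by rw [mul_one]; exact hc.2
  have hpt : AffineMap.lineMap z₀ ((1 - (c : ℂ)) * z₀ + (c : ℂ) * η₀) θ =
      (1 - ((c * θ : ℝ) : ℂ)) * z₀ + ((c * θ : ℝ) : ℂ) * η₀ := by
    rw [AffineMap.lineMap_apply_module]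
    simp only [Complex.real_smul]
    push_cast
    ring
  obtain ⟨hslit, hηw, -, hy'⟩ := ratioBase_segment_mem_slitPlane hz₀ hη₀ hne hθc
  refine ⟨?_, hη₀, ?_, hne, ?_⟩
  · show 0 < (AffineMap.lineMap z₀ ((1 - (c : ℂ)) * z₀ + (c : ℂ) * η₀) θ).im
    rw [hpt]; exact hy'
  · show η₀ ≠ AffineMap.lineMap z₀ ((1 - (c : ℂ)) * z₀ + (c : ℂ) * η₀) θ
    rw [hpt]; exact hηw
  · show poissonKernelC η₀ (AffineMap.lineMap z₀ ((1 - (c : ℂ)) * z₀ + (c : ℂ) * η₀) θ) /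
      poissonKernelC η₀ z₀ ∈ Complex.slitPlane
    rw [hpt]; exact hslit

/-- **Uniform good neighbourhood.** For `z₀, η₀ ∈ ℍ`, `η₀ ≠ z₀`, `0 ≤ c < 1` there is `δ > 0` such
that every parameter `η` within `δ` of `η₀` and every point `w` within `δ` of the truncated
segment `[z₀, z_c]` form a good pair. [folklore] -/
theorem exists_uniform_good_nhd {z₀ η₀ : ℂ} (hz₀ : 0 < z₀.im) (hη₀ : 0 < η₀.im) (hne : η₀ ≠ z₀)
    {c : ℝ} (hc : c ∈ Ico (0 : ℝ) 1) :
    ∃ δ > 0, ∀ η ∈ Metric.ball η₀ δ,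
      ∀ w ∈ Metric.thickening δ (segment ℝ z₀ ((1 - (c : ℂ)) * z₀ + (c : ℂ) * η₀)),
        (η, w) ∈ {q : ℂ × ℂ | 0 < q.2.im ∧ 0 < q.1.im ∧ q.1 ≠ q.2 ∧ q.1 ≠ z₀ ∧
          poissonKernelC q.1 q.2 / poissonKernelC q.1 z₀ ∈ Complex.slitPlane} := by
  set K : Set (ℂ × ℂ) := ({η₀} : Set ℂ) ×ˢ segment ℝ z₀ ((1 - (c : ℂ)) * z₀ + (c : ℂ) * η₀) with hK
  have hKc : IsCompact K := isCompact_singleton.prod (by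
    rw [segment_eq_image_lineMap]
    exact isCompact_Icc.image (AffineMap.lineMap_continuous))
  have hKO : K ⊆ {q : ℂ × ℂ | 0 < q.2.im ∧ 0 < q.1.im ∧ q.1 ≠ q.2 ∧ q.1 ≠ z₀ ∧
      poissonKernelC q.1 q.2 / poissonKernelC q.1 z₀ ∈ Complex.slitPlane} := by
    rintro ⟨η, w⟩ ⟨hη, hw⟩
    have hη' : η = η₀ := hη
    subst hη'
    exact segment_truncated_good hz₀ hη₀ hne hc hw
  obtain ⟨δ, hδ, hδO⟩ := hKc.exists_thickening_subset_open (isOpen_goodPairs hz₀) hKO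
  refine ⟨δ, hδ, fun η hη w hw => hδO ?_⟩
  rw [Metric.mem_thickening_iff] at hw ⊢
  obtain ⟨w', hw', hww'⟩ := hw
  refine ⟨(η₀, w'), ⟨rfl, hw'⟩, ?_⟩
  rw [Prod.dist_eq]
  exact max_lt (Metric.mem_ball.mp hη) hww'

end UniformGoodNeighbourhood

section Term1

variable {s : ℂ}

/-- Holomorphy in the parameter of the complexified kernel: `η ↦ R_η(w)` is complex-differentiable
at `η` with `η ≠ w, w̄`. [folklore] -/
theorem differentiableAt_poissonKernelC_param {η w : ℂ} (hηw : η ≠ w) (hηw' : η ≠ conj w) :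
    DifferentiableAt ℂ (fun ζ : ℂ => poissonKernelC ζ w) η := by
  unfold poissonKernelC
  refine (differentiableAt_const _).div (by fun_prop) ?_
  exact mul_ne_zero (sub_ne_zero.mpr hηw) (sub_ne_zero.mpr hηw')

/-- Holomorphy of `η ↦ (R_η(w)/R_η(z₀))^s` at a good pair. [cite: BruggemanLewisZagier2015, (1.7) p. 10] -/
theorem differentiableAt_ratioKernel_param (s : ℂ) {z₀ η w : ℂ} (hz₀ : 0 < z₀.im)
    (h : (η, w) ∈ {q : ℂ × ℂ | 0 < q.2.im ∧ 0 < q.1.im ∧ q.1 ≠ q.2 ∧ q.1 ≠ z₀ ∧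
      poissonKernelC q.1 q.2 / poissonKernelC q.1 z₀ ∈ Complex.slitPlane}) :
    DifferentiableAt ℂ (fun ζ : ℂ => ratioKernel s z₀ ζ w) η := by
  obtain ⟨hw, hηw, _, hηw', hpz, hslit⟩ := goodPair_props hz₀ h
  have hη : 0 < η.im := h.2.1
  have hηz₀ : η ≠ z₀ := h.2.2.2.1
  have hηz₀' : η ≠ conj z₀ := by
    intro hh; have := congrArg Complex.im hh; simp at this; linarith
  unfold ratioKernel
  exact ((differentiableAt_poissonKernelC_param hηw hηw').div
    (differentiableAt_poissonKernelC_param hηz₀ hηz₀') hpz).cpow_const hslit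

/-- Joint continuity of `(η, w) ↦ (R_η(w)/R_η(z₀))^s` at good pairs. [folklore] -/
theorem continuousOn_ratioKernel_pair (s : ℂ) {z₀ : ℂ} (hz₀ : 0 < z₀.im) :
    ContinuousOn (fun q : ℂ × ℂ => ratioKernel s z₀ q.1 q.2)
      {q : ℂ × ℂ | 0 < q.2.im ∧ 0 < q.1.im ∧ q.1 ≠ q.2 ∧ q.1 ≠ z₀ ∧
        poissonKernelC q.1 q.2 / poissonKernelC q.1 z₀ ∈ Complex.slitPlane} := by
  intro q hq
  obtain ⟨hw, hηw, _, hηw', hpz, hslit⟩ := goodPair_props hz₀ hq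
  have hη : 0 < q.1.im := hq.2.1
  have hηz₀ : q.1 ≠ z₀ := hq.2.2.2.1
  have hηz₀' : q.1 ≠ conj z₀ := by
    intro hh; have := congrArg Complex.im hh; simp at this; linarith
  unfold ratioKernel
  refine ContinuousWithinAt.cpow ?_ continuousWithinAt_const hslit
  apply ContinuousAt.continuousWithinAt
  simp only [poissonKernelC]
  refine ContinuousAt.div ?_ ?_ hpz
  · refine ContinuousAt.div (by fun_prop) (by fun_prop) ?_
    exact mul_ne_zero (sub_ne_zero.mpr hηw) (sub_ne_zero.mpr hηw')
  · refine ContinuousAt.div (by fun_prop) (by fun_prop) ?_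
    exact mul_ne_zero (sub_ne_zero.mpr hηz₀) (sub_ne_zero.mpr hηz₀')

attribute [local irreducible] ratioKernel poissonKernelC in
/-- **Holomorphy in the kernel parameter of the segment integral over a fixed truncated segment**:
for `0 ≤ c < 1`, `η ↦ ∫_{z₀}^{z_c} [U, (R_η/R_η(z₀))^s]` with `z_c = (1-c) z₀ + c η₀` is complex
differentiable at `η₀` (the integrand depends holomorphically on `η`; dominated differentiation
as packaged in `Literature.Analysis.Complex.differentiableOn_intervalIntegral_of_continuousOn`).
[cite: BruggemanLewisZagier2015, (1.7) p. 10] -/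
theorem differentiableAt_greenSegmentIntegral_param (s : ℂ) {U : ℂ → ℂ}
    (hU : ContDiffOn ℝ 2 U {z : ℂ | 0 < z.im}) {z₀ η₀ : ℂ} (hz₀ : 0 < z₀.im) (hη₀ : 0 < η₀.im)
    (hne : η₀ ≠ z₀) {c : ℝ} (hc : c ∈ Ico (0 : ℝ) 1) :
    DifferentiableAt ℂ (fun η : ℂ =>
      greenSegmentIntegral U (ratioKernel s z₀ η) z₀ ((1 - (c : ℂ)) * z₀ + (c : ℂ) * η₀)) η₀ := by
  obtain ⟨δ, hδ, hgood⟩ := exists_uniform_good_nhd hz₀ hη₀ hne hc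
  set b : ℂ := (1 - (c : ℂ)) * z₀ + (c : ℂ) * η₀ with hb
  set hv : ℂ := b - z₀ with hhv
  -- the segment map of `[z₀, b]` and its goodness
  have hseg : ∀ σ ∈ Icc (0 : ℝ) 1, (1 - (σ : ℂ)) * z₀ + (σ : ℂ) * b ∈ segment ℝ z₀ b := by
    intro σ hσ
    rw [segment_eq_image_lineMap]
    refine ⟨σ, hσ, ?_⟩
    rw [AffineMap.lineMap_apply_module]; simp only [Complex.real_smul]; push_cast; ring
  have hgood' : ∀ η ∈ Metric.ball η₀ δ, ∀ σ ∈ Icc (0 : ℝ) 1,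
      (η, (1 - (σ : ℂ)) * z₀ + (σ : ℂ) * b) ∈ {q : ℂ × ℂ | 0 < q.2.im ∧ 0 < q.1.im ∧ q.1 ≠ q.2 ∧
        q.1 ≠ z₀ ∧ poissonKernelC q.1 q.2 / poissonKernelC q.1 z₀ ∈ Complex.slitPlane} :=
    fun η hη σ hσ => hgood η hη _ (Metric.self_subset_thickening hδ _ (hseg σ hσ))
  -- the explicit integrand
  set g : ℂ → ℝ → ℂ := fun η σ =>
    wirtingerDz U ((1 - (σ : ℂ)) * z₀ + (σ : ℂ) * b) *
        ratioKernel s z₀ η ((1 - (σ : ℂ)) * z₀ + (σ : ℂ) * b) * hv +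
      U ((1 - (σ : ℂ)) * z₀ + (σ : ℂ) * b) *
        (ratioKernel s z₀ η ((1 - (σ : ℂ)) * z₀ + (σ : ℂ) * b) *
          (s * Complex.I * (η - ((1 - (σ : ℂ)) * z₀ + (σ : ℂ) * b)) /
            (2 * ((((1 - (σ : ℂ)) * z₀ + (σ : ℂ) * b).im : ℝ) : ℂ) *
              (η - conj ((1 - (σ : ℂ)) * z₀ + (σ : ℂ) * b))))) * conj hv with hg
  -- (i) the segment integral is `∫ g` on the ball
  have heq : ∀ η ∈ Metric.ball η₀ δ,
      greenSegmentIntegral U (ratioKernel s z₀ η) z₀ b = ∫ σ in (0:ℝ)..1, g η σ := by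
    intro η hη
    unfold greenSegmentIntegral
    refine intervalIntegral.integral_congr fun σ hσ => ?_
    rw [uIcc_of_le zero_le_one] at hσ
    obtain ⟨hw, hηw, _, hηw', hpz, hslit⟩ := goodPair_props hz₀ (hgood' η hη σ hσ)
    simp only [hg, greenForm, ← hhv]
    rw [wirtingerDzbar_ratioKernel s hw hηw hηw' hpz hslit]
  -- (ii) holomorphy of `∫ g` on the ball
  have hO : IsOpen {z : ℂ | 0 < z.im} := isOpen_upperHalfPlaneSet
  have hdiff : ∀ σ ∈ Icc (0 : ℝ) 1, DifferentiableOn ℂ (fun η => g η σ) (Metric.ball η₀ δ) := by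
    intro σ hσ η hη
    apply DifferentiableAt.differentiableWithinAt
    obtain ⟨hw, hηw, _, hηw', hpz, hslit⟩ := goodPair_props hz₀ (hgood' η hη σ hσ)
    have hV := differentiableAt_ratioKernel_param s hz₀ (hgood' η hη σ hσ)
    have hden : 2 * ((((1 - (σ : ℂ)) * z₀ + (σ : ℂ) * b).im : ℝ) : ℂ) *
        (η - conj ((1 - (σ : ℂ)) * z₀ + (σ : ℂ) * b)) ≠ 0 :=
      mul_ne_zero (mul_ne_zero two_ne_zero (by exact_mod_cast hw.ne')) (sub_ne_zero.mpr hηw')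
    simp only [hg]
    refine (((differentiableAt_const _).mul hV).mul (differentiableAt_const _)).add ?_
    refine ((differentiableAt_const _).mul (hV.mul ?_)).mul (differentiableAt_const _)
    exact DifferentiableAt.div (by fun_prop) (by fun_prop) hden
  have hcont : ContinuousOn (Function.uncurry g) (Metric.ball η₀ δ ×ˢ Icc (0 : ℝ) 1) := by
    have hmaps : MapsTo (fun q : ℂ × ℝ => (q.1, (1 - (q.2 : ℂ)) * z₀ + (q.2 : ℂ) * b))
        (Metric.ball η₀ δ ×ˢ Icc (0 : ℝ) 1)
        {q : ℂ × ℂ | 0 < q.2.im ∧ 0 < q.1.im ∧ q.1 ≠ q.2 ∧ q.1 ≠ z₀ ∧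
          poissonKernelC q.1 q.2 / poissonKernelC q.1 z₀ ∈ Complex.slitPlane} :=
      fun q hq => hgood' q.1 hq.1 q.2 hq.2
    have hpt : Continuous (fun q : ℂ × ℝ => (1 - (q.2 : ℂ)) * z₀ + (q.2 : ℂ) * b) := by fun_prop
    have hV : ContinuousOn (fun q : ℂ × ℝ => ratioKernel s z₀ q.1 ((1 - (q.2 : ℂ)) * z₀ + (q.2 : ℂ) * b))
        (Metric.ball η₀ δ ×ˢ Icc (0 : ℝ) 1) :=
      ContinuousOn.comp (g := fun q : ℂ × ℂ => ratioKernel s z₀ q.1 q.2)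
        (f := fun q : ℂ × ℝ => (q.1, (1 - (q.2 : ℂ)) * z₀ + (q.2 : ℂ) * b))
        (continuousOn_ratioKernel_pair s hz₀) (by fun_prop) hmaps
    have hmapsH : MapsTo (fun q : ℂ × ℝ => (1 - (q.2 : ℂ)) * z₀ + (q.2 : ℂ) * b)
        (Metric.ball η₀ δ ×ˢ Icc (0 : ℝ) 1) {z : ℂ | 0 < z.im} :=
      fun q hq => (hgood' q.1 hq.1 q.2 hq.2).1
    have hUc : ContinuousOn (fun q : ℂ × ℝ => U ((1 - (q.2 : ℂ)) * z₀ + (q.2 : ℂ) * b))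
        (Metric.ball η₀ δ ×ˢ Icc (0 : ℝ) 1) := hU.continuousOn.comp hpt.continuousOn hmapsH
    have hDzc : ContinuousOn (fun q : ℂ × ℝ => wirtingerDz U ((1 - (q.2 : ℂ)) * z₀ + (q.2 : ℂ) * b))
        (Metric.ball η₀ δ ×ˢ Icc (0 : ℝ) 1) :=
      (continuousOn_wirtingerDz hO hU).comp hpt.continuousOn hmapsH
    have hfrac : ContinuousOn (fun q : ℂ × ℝ =>
        s * Complex.I * (q.1 - ((1 - (q.2 : ℂ)) * z₀ + (q.2 : ℂ) * b)) /
          (2 * ((((1 - (q.2 : ℂ)) * z₀ + (q.2 : ℂ) * b).im : ℝ) : ℂ) *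
            (q.1 - conj ((1 - (q.2 : ℂ)) * z₀ + (q.2 : ℂ) * b))))
        (Metric.ball η₀ δ ×ˢ Icc (0 : ℝ) 1) := by
      refine ContinuousOn.div (by fun_prop) ?_ ?_
      · exact ((continuous_const.mul (Complex.continuous_ofReal.comp (Complex.continuous_im.comp hpt))).mul
          (continuous_fst.sub (Complex.continuous_conj.comp hpt))).continuousOn
      · intro q hq
        obtain ⟨hw, _, _, hηw', _, _⟩ := goodPair_props hz₀ (hgood' q.1 hq.1 q.2 hq.2)
        exact mul_ne_zero (mul_ne_zero two_ne_zero (by exact_mod_cast hw.ne')) (sub_ne_zero.mpr hηw')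
    have : Function.uncurry g = fun q : ℂ × ℝ =>
        wirtingerDz U ((1 - (q.2 : ℂ)) * z₀ + (q.2 : ℂ) * b) *
            ratioKernel s z₀ q.1 ((1 - (q.2 : ℂ)) * z₀ + (q.2 : ℂ) * b) * hv +
          U ((1 - (q.2 : ℂ)) * z₀ + (q.2 : ℂ) * b) *
            (ratioKernel s z₀ q.1 ((1 - (q.2 : ℂ)) * z₀ + (q.2 : ℂ) * b) *
              (s * Complex.I * (q.1 - ((1 - (q.2 : ℂ)) * z₀ + (q.2 : ℂ) * b)) /
                (2 * ((((1 - (q.2 : ℂ)) * z₀ + (q.2 : ℂ) * b).im : ℝ) : ℂ) *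
                  (q.1 - conj ((1 - (q.2 : ℂ)) * z₀ + (q.2 : ℂ) * b))))) * conj hv := by
      funext q; simp only [Function.uncurry, hg]
    rw [this]
    exact ((hDzc.mul hV).mul continuousOn_const).add ((hUc.mul (hV.mul hfrac)).mul continuousOn_const)
  have hD := Literature.Analysis.Complex.differentiableOn_intervalIntegral_of_continuousOn
    Metric.isOpen_ball zero_le_one hdiff hcont
  -- (iii) transfer
  have hball : Metric.ball η₀ δ ∈ 𝓝 η₀ := Metric.ball_mem_nhds η₀ hδ
  refine (hD.differentiableAt hball).congr_of_eventuallyEq ?_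
  filter_upwards [hball] with η hη
  exact heq η hη

end Term1

section Term2

variable {s : ℂ}

/-- The Green's form against the ratio kernel at a good pair, explicitly ((4.24) of the companion
paper): `[U, V_η](w)(h) = U_z V_η h + U V_η · s i (η-w)/(2 Im w (η - w̄)) · h̄`.
[cite: BruggemanLewisZagier2015, (1.7) p. 10] -/
theorem greenForm_ratioKernel_of_good (s : ℂ) (U : ℂ → ℂ) {z₀ η w : ℂ} (hz₀ : 0 < z₀.im)
    (h : (η, w) ∈ {q : ℂ × ℂ | 0 < q.2.im ∧ 0 < q.1.im ∧ q.1 ≠ q.2 ∧ q.1 ≠ z₀ ∧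
      poissonKernelC q.1 q.2 / poissonKernelC q.1 z₀ ∈ Complex.slitPlane}) (hvec : ℂ) :
    greenForm U (ratioKernel s z₀ η) w hvec =
      wirtingerDz U w * ratioKernel s z₀ η w * hvec +
        U w * (ratioKernel s z₀ η w * (s * Complex.I * (η - w) /
          (2 * ((w.im : ℝ) : ℂ) * (η - conj w)))) * conj hvec := by
  obtain ⟨hw, hηw, _, hηw', hpz, hslit⟩ := goodPair_props hz₀ h
  rw [greenForm, wirtingerDzbar_ratioKernel s hw hηw hηw' hpz hslit]

/-- The two coefficient functions of the Green's form against the ratio kernel are jointly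
continuous in `(η, w)` on the good set (for `U` of class `C²` on `ℍ`). [folklore] -/
theorem continuousOn_greenCoeffs (s : ℂ) {U : ℂ → ℂ} (hU : ContDiffOn ℝ 2 U {z : ℂ | 0 < z.im})
    {z₀ : ℂ} (hz₀ : 0 < z₀.im) :
    ContinuousOn (fun q : ℂ × ℂ => (wirtingerDz U q.2 * ratioKernel s z₀ q.1 q.2,
        U q.2 * (ratioKernel s z₀ q.1 q.2 * (s * Complex.I * (q.1 - q.2) /
          (2 * ((q.2.im : ℝ) : ℂ) * (q.1 - conj q.2))))))
      {q : ℂ × ℂ | 0 < q.2.im ∧ 0 < q.1.im ∧ q.1 ≠ q.2 ∧ q.1 ≠ z₀ ∧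
        poissonKernelC q.1 q.2 / poissonKernelC q.1 z₀ ∈ Complex.slitPlane} := by
  have hO : IsOpen {z : ℂ | 0 < z.im} := isOpen_upperHalfPlaneSet
  have hmaps : MapsTo (fun q : ℂ × ℂ => q.2)
      {q : ℂ × ℂ | 0 < q.2.im ∧ 0 < q.1.im ∧ q.1 ≠ q.2 ∧ q.1 ≠ z₀ ∧
        poissonKernelC q.1 q.2 / poissonKernelC q.1 z₀ ∈ Complex.slitPlane} {z : ℂ | 0 < z.im} :=
    fun q hq => hq.1
  have hV := continuousOn_ratioKernel_pair s hz₀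
  have hUc : ContinuousOn (fun q : ℂ × ℂ => U q.2)
      {q : ℂ × ℂ | 0 < q.2.im ∧ 0 < q.1.im ∧ q.1 ≠ q.2 ∧ q.1 ≠ z₀ ∧
        poissonKernelC q.1 q.2 / poissonKernelC q.1 z₀ ∈ Complex.slitPlane} :=
    hU.continuousOn.comp continuous_snd.continuousOn hmaps
  have hDz : ContinuousOn (fun q : ℂ × ℂ => wirtingerDz U q.2)
      {q : ℂ × ℂ | 0 < q.2.im ∧ 0 < q.1.im ∧ q.1 ≠ q.2 ∧ q.1 ≠ z₀ ∧
        poissonKernelC q.1 q.2 / poissonKernelC q.1 z₀ ∈ Complex.slitPlane} :=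
    (continuousOn_wirtingerDz hO hU).comp continuous_snd.continuousOn hmaps
  have hfrac : ContinuousOn (fun q : ℂ × ℂ => s * Complex.I * (q.1 - q.2) /
      (2 * ((q.2.im : ℝ) : ℂ) * (q.1 - conj q.2)))
      {q : ℂ × ℂ | 0 < q.2.im ∧ 0 < q.1.im ∧ q.1 ≠ q.2 ∧ q.1 ≠ z₀ ∧
        poissonKernelC q.1 q.2 / poissonKernelC q.1 z₀ ∈ Complex.slitPlane} := by
    refine ContinuousOn.div (by fun_prop) (by fun_prop) ?_
    intro q hq
    obtain ⟨hw, _, _, hηw', _, _⟩ := goodPair_props hz₀ hq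
    exact mul_ne_zero (mul_ne_zero two_ne_zero (by exact_mod_cast hw.ne')) (sub_ne_zero.mpr hηw')
  exact (hDz.mul hV).prodMk (hUc.mul (hV.mul hfrac))

attribute [local irreducible] ratioKernel poissonKernelC in
/-- **The derivative of the integral over the short moving segment.** For `0 ≤ c < 1`, the map
`η ↦ ∫_{z_c(η₀)}^{z_c(η)} [U, (R_η/R_η(z₀))^s]`, `z_c(η) = (1-c) z₀ + c η`, vanishes at `η₀` and has
there the Fréchet derivative `h ↦ c (A h + B h̄)` with `A = U_z(z_c(η₀)) V_{η₀}(z_c(η₀))` and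
`B = U(z_c(η₀)) ∂̄V_{η₀}(z_c(η₀))` (the Green's form at the base of the short segment evaluated on
its tangent `c(η - η₀)`). [folklore] -/
theorem hasFDerivAt_greenSegmentIntegral_short (s : ℂ) {U : ℂ → ℂ}
    (hU : ContDiffOn ℝ 2 U {z : ℂ | 0 < z.im}) {z₀ η₀ : ℂ} (hz₀ : 0 < z₀.im) (hη₀ : 0 < η₀.im)
    (hne : η₀ ≠ z₀) {c : ℝ} (hc : c ∈ Ico (0 : ℝ) 1) :
    HasFDerivAt (fun η : ℂ => greenSegmentIntegral U (ratioKernel s z₀ η)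
        ((1 - (c : ℂ)) * z₀ + (c : ℂ) * η₀) ((1 - (c : ℂ)) * z₀ + (c : ℂ) * η))
      (((c : ℂ) * (wirtingerDz U ((1 - (c : ℂ)) * z₀ + (c : ℂ) * η₀) *
          ratioKernel s z₀ η₀ ((1 - (c : ℂ)) * z₀ + (c : ℂ) * η₀))) • ContinuousLinearMap.id ℝ ℂ +
        ((c : ℂ) * (U ((1 - (c : ℂ)) * z₀ + (c : ℂ) * η₀) *
          (ratioKernel s z₀ η₀ ((1 - (c : ℂ)) * z₀ + (c : ℂ) * η₀) *
            (s * Complex.I * (η₀ - ((1 - (c : ℂ)) * z₀ + (c : ℂ) * η₀)) /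
              (2 * (((((1 - (c : ℂ)) * z₀ + (c : ℂ) * η₀)).im : ℝ) : ℂ) *
                (η₀ - conj ((1 - (c : ℂ)) * z₀ + (c : ℂ) * η₀))))))) •
          (Complex.conjCLE : ℂ →L[ℝ] ℂ)) η₀ := by
  obtain ⟨δ, hδ, hgood⟩ := exists_uniform_good_nhd hz₀ hη₀ hne hc
  set b : ℂ := (1 - (c : ℂ)) * z₀ + (c : ℂ) * η₀ with hb
  set Fq : ℂ × ℂ → ℂ × ℂ := fun q => (wirtingerDz U q.2 * ratioKernel s z₀ q.1 q.2,
      U q.2 * (ratioKernel s z₀ q.1 q.2 * (s * Complex.I * (q.1 - q.2) /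
        (2 * ((q.2.im : ℝ) : ℂ) * (q.1 - conj q.2))))) with hFq
  set A : ℂ := (Fq (η₀, b)).1 with hA
  set B : ℂ := (Fq (η₀, b)).2 with hB
  have hbgood : (η₀, b) ∈ {q : ℂ × ℂ | 0 < q.2.im ∧ 0 < q.1.im ∧ q.1 ≠ q.2 ∧ q.1 ≠ z₀ ∧
      poissonKernelC q.1 q.2 / poissonKernelC q.1 z₀ ∈ Complex.slitPlane} :=
    hgood η₀ (Metric.mem_ball_self hδ) b (Metric.self_subset_thickening hδ _ (right_mem_segment ℝ z₀ b))
  have hcontF : ContinuousAt Fq (η₀, b) :=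
    ((continuousOn_greenCoeffs s hU hz₀).continuousAt ((isOpen_goodPairs hz₀).mem_nhds hbgood))
  -- restate the derivative with `A`, `B`
  have hL : (((c : ℂ) * (wirtingerDz U b * ratioKernel s z₀ η₀ b)) • ContinuousLinearMap.id ℝ ℂ +
      ((c : ℂ) * (U b * (ratioKernel s z₀ η₀ b * (s * Complex.I * (η₀ - b) /
        (2 * ((b.im : ℝ) : ℂ) * (η₀ - conj b)))))) • (Complex.conjCLE : ℂ →L[ℝ] ℂ)) =
      ((c : ℂ) * A) • ContinuousLinearMap.id ℝ ℂ + ((c : ℂ) * B) • (Complex.conjCLE : ℂ →L[ℝ] ℂ) := by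
    simp only [hA, hB, hFq]
  rw [hL, hasFDerivAt_iff_isLittleO_nhds_zero, Asymptotics.isLittleO_iff]
  intro γ hγ
  -- continuity of the coefficients at `(η₀, b)`
  have hγ2 : 0 < γ / 2 := by positivity
  obtain ⟨ρ, hρ, hρF⟩ : ∃ ρ > 0, ∀ q : ℂ × ℂ, dist q (η₀, b) < ρ → dist (Fq q) (Fq (η₀, b)) < γ / 2 :=
    Metric.continuousAt_iff.mp hcontF (γ / 2) hγ2
  have hc0 : 0 ≤ c := hc.1
  have hc1 : c < 1 := hc.2
  filter_upwards [Metric.ball_mem_nhds (0 : ℂ) (lt_min hδ hρ)] with h hh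
  rw [Metric.mem_ball, dist_zero_right] at hh
  have hhδ : ‖h‖ < δ := lt_of_lt_of_le hh (min_le_left _ _)
  have hhρ : ‖h‖ < ρ := lt_of_lt_of_le hh (min_le_right _ _)
  -- the value at `η₀` vanishes
  have h0 : greenSegmentIntegral U (ratioKernel s z₀ η₀) b ((1 - (c : ℂ)) * z₀ + (c : ℂ) * η₀) = 0 := by
    rw [← hb]; exact greenSegmentIntegral_self _ _ _
  -- the points of the short segment are good and close to `b`
  have hend : (1 - (c : ℂ)) * z₀ + (c : ℂ) * (η₀ + h) = b + (c : ℂ) * h := by rw [hb]; ring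
  have hpt : ∀ σ : ℝ, (1 - (σ : ℂ)) * b + (σ : ℂ) * (b + (c : ℂ) * h) = b + ((σ * c : ℝ) : ℂ) * h := by
    intro σ; push_cast; ring
  have hclose : ∀ σ ∈ Icc (0 : ℝ) 1, dist ((η₀ + h, b + ((σ * c : ℝ) : ℂ) * h) : ℂ × ℂ) (η₀, b) < ρ ∧
      (η₀ + h, b + ((σ * c : ℝ) : ℂ) * h) ∈ {q : ℂ × ℂ | 0 < q.2.im ∧ 0 < q.1.im ∧ q.1 ≠ q.2 ∧
        q.1 ≠ z₀ ∧ poissonKernelC q.1 q.2 / poissonKernelC q.1 z₀ ∈ Complex.slitPlane} := by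
    intro σ hσ
    have hσc : |σ * c| ≤ 1 := by
      rw [abs_of_nonneg (mul_nonneg hσ.1 hc0)]
      nlinarith [hσ.2, hc1, mul_nonneg hσ.1 hc0]
    have hsmall : ‖((σ * c : ℝ) : ℂ) * h‖ ≤ ‖h‖ := by
      rw [norm_mul, Complex.norm_real, Real.norm_eq_abs]
      calc |σ * c| * ‖h‖ ≤ 1 * ‖h‖ := mul_le_mul_of_nonneg_right hσc (norm_nonneg _)
        _ = ‖h‖ := one_mul _
    refine ⟨?_, hgood (η₀ + h) ?_ _ ?_⟩
    · rw [Prod.dist_eq, dist_eq_norm, dist_eq_norm, add_sub_cancel_left, add_sub_cancel_left]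
      exact max_lt hhρ (lt_of_le_of_lt hsmall hhρ)
    · rw [Metric.mem_ball, dist_eq_norm, add_sub_cancel_left]; exact hhδ
    · rw [Metric.mem_thickening_iff]
      refine ⟨b, right_mem_segment ℝ z₀ b, ?_⟩
      rw [dist_eq_norm, add_sub_cancel_left]
      exact lt_of_le_of_lt hsmall hhδ
  -- the integrand and its distance to the linear part
  have hint : ∀ σ ∈ Icc (0 : ℝ) 1,
      ‖greenForm U (ratioKernel s z₀ (η₀ + h)) (b + ((σ * c : ℝ) : ℂ) * h) ((c : ℂ) * h) -
        ((c : ℂ) * A * h + (c : ℂ) * B * conj h)‖ ≤ γ * ‖h‖ := by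
    intro σ hσ
    obtain ⟨hdist, hgd⟩ := hclose σ hσ
    rw [greenForm_ratioKernel_of_good s U hz₀ hgd]
    have hF1 := hρF _ hdist
    rw [Prod.dist_eq] at hF1
    have hF1a : dist (Fq (η₀ + h, b + ((σ * c : ℝ) : ℂ) * h)).1 A < γ / 2 :=
      lt_of_le_of_lt (le_max_left _ _) hF1
    have hF1b : dist (Fq (η₀ + h, b + ((σ * c : ℝ) : ℂ) * h)).2 B < γ / 2 :=
      lt_of_le_of_lt (le_max_right _ _) hF1
    simp only [hFq, dist_eq_norm] at hF1a hF1b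
    set A' := wirtingerDz U (b + ((σ * c : ℝ) : ℂ) * h) * ratioKernel s z₀ (η₀ + h) (b + ((σ * c : ℝ) : ℂ) * h)
      with hA'
    set B' := U (b + ((σ * c : ℝ) : ℂ) * h) * (ratioKernel s z₀ (η₀ + h) (b + ((σ * c : ℝ) : ℂ) * h) *
      (s * Complex.I * (η₀ + h - (b + ((σ * c : ℝ) : ℂ) * h)) /
        (2 * (((b + ((σ * c : ℝ) : ℂ) * h).im : ℝ) : ℂ) * (η₀ + h - conj (b + ((σ * c : ℝ) : ℂ) * h)))))
      with hB'
    have e : A' * ((c : ℂ) * h) + B' * conj ((c : ℂ) * h) - ((c : ℂ) * A * h + (c : ℂ) * B * conj h) =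
        (c : ℂ) * ((A' - A) * h + (B' - B) * conj h) := by
      simp only [map_mul, Complex.conj_ofReal]; ring
    rw [e, norm_mul, Complex.norm_real, Real.norm_eq_abs, abs_of_nonneg hc0]
    have hn : ‖(A' - A) * h + (B' - B) * conj h‖ ≤ γ * ‖h‖ := by
      calc ‖(A' - A) * h + (B' - B) * conj h‖ ≤ ‖(A' - A) * h‖ + ‖(B' - B) * conj h‖ := norm_add_le _ _
        _ = ‖A' - A‖ * ‖h‖ + ‖B' - B‖ * ‖h‖ := by rw [norm_mul, norm_mul, Complex.norm_conj]
        _ ≤ γ / 2 * ‖h‖ + γ / 2 * ‖h‖ := by gcongr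
        _ = γ * ‖h‖ := by ring
    calc c * ‖(A' - A) * h + (B' - B) * conj h‖ ≤ 1 * (γ * ‖h‖) :=
          mul_le_mul hc1.le hn (norm_nonneg _) zero_le_one
      _ = γ * ‖h‖ := one_mul _
  -- integrability of the integrand (continuous in `σ`)
  have hAB_int : IntervalIntegrable (fun σ : ℝ =>
      greenForm U (ratioKernel s z₀ (η₀ + h)) (b + ((σ * c : ℝ) : ℂ) * h) ((c : ℂ) * h)) volume 0 1 := by
    apply ContinuousOn.intervalIntegrable
    rw [uIcc_of_le zero_le_one]
    have hmaps : MapsTo (fun σ : ℝ => ((η₀ + h, b + ((σ * c : ℝ) : ℂ) * h) : ℂ × ℂ)) (Icc (0:ℝ) 1)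
        {q : ℂ × ℂ | 0 < q.2.im ∧ 0 < q.1.im ∧ q.1 ≠ q.2 ∧ q.1 ≠ z₀ ∧
          poissonKernelC q.1 q.2 / poissonKernelC q.1 z₀ ∈ Complex.slitPlane} :=
      fun σ hσ => (hclose σ hσ).2
    have hFσ : ContinuousOn (fun σ : ℝ => Fq (η₀ + h, b + ((σ * c : ℝ) : ℂ) * h)) (Icc (0:ℝ) 1) :=
      (continuousOn_greenCoeffs s hU hz₀).comp (by fun_prop) hmaps
    have heqσ : EqOn (fun σ : ℝ =>
        greenForm U (ratioKernel s z₀ (η₀ + h)) (b + ((σ * c : ℝ) : ℂ) * h) ((c : ℂ) * h))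
        (fun σ => (Fq (η₀ + h, b + ((σ * c : ℝ) : ℂ) * h)).1 * ((c : ℂ) * h) +
          (Fq (η₀ + h, b + ((σ * c : ℝ) : ℂ) * h)).2 * conj ((c : ℂ) * h)) (Icc (0:ℝ) 1) := by
      intro σ hσ
      simp only [hFq]
      exact greenForm_ratioKernel_of_good s U hz₀ (hclose σ hσ).2 _
    refine ContinuousOn.congr ?_ heqσ
    exact ((continuous_fst.comp_continuousOn hFσ).mul continuousOn_const).add
      ((continuous_snd.comp_continuousOn hFσ).mul continuousOn_const)
  -- conclude
  have hval : greenSegmentIntegral U (ratioKernel s z₀ (η₀ + h)) b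
      ((1 - (c : ℂ)) * z₀ + (c : ℂ) * (η₀ + h)) =
      ∫ σ in (0:ℝ)..1, greenForm U (ratioKernel s z₀ (η₀ + h)) (b + ((σ * c : ℝ) : ℂ) * h) ((c : ℂ) * h) := by
    unfold greenSegmentIntegral
    rw [hend]
    refine intervalIntegral.integral_congr fun σ _ => ?_
    simp only [hpt, add_sub_cancel_left]
  rw [h0, sub_zero, hval]
  have hlin : ((((c : ℂ) * A) • ContinuousLinearMap.id ℝ ℂ + ((c : ℂ) * B) • (Complex.conjCLE : ℂ →L[ℝ] ℂ)) h) =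
      ∫ _σ in (0:ℝ)..1, ((c : ℂ) * A * h + (c : ℂ) * B * conj h) := by
    rw [intervalIntegral.integral_const]
    simp [smul_eq_mul, mul_assoc]
  rw [hlin, ← intervalIntegral.integral_sub hAB_int intervalIntegrable_const]
  calc ‖∫ σ in (0:ℝ)..1, (greenForm U (ratioKernel s z₀ (η₀ + h)) (b + ((σ * c : ℝ) : ℂ) * h) ((c : ℂ) * h) -
        ((c : ℂ) * A * h + (c : ℂ) * B * conj h))‖ ≤ (γ * ‖h‖) * |(1:ℝ) - 0| := by
        refine intervalIntegral.norm_integral_le_of_norm_le_const fun σ hσ => ?_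
        rw [uIoc_of_le zero_le_one] at hσ
        exact hint σ (Ioc_subset_Icc_self hσ)
    _ = γ * ‖h‖ := by simp

end Term2

section TruncatedDerivative

variable {Γ : Subgroup (GL (Fin 2) ℝ)} {s : ℂ} {u : ℍ → ℂ}

attribute [local irreducible] ratioKernel poissonKernelC in
/-- **The `∂̄`-part of the derivative of the truncated canonical integral.** For `u ∈ E_s^Γ`
(`s ≠ 0, 1`), `z₀, η₀ ∈ ℍ`, `η₀ ≠ z₀` and `0 ≤ c < 1`, the truncated canonical integral
`I_c(η) = ∫_{z₀}^{z_c(η)} [u, (R_η/R_η(z₀))^s]`, `z_c(η) = (1-c) z₀ + c η`, is real-differentiable at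
`η₀` with a derivative `L` whose `∂̄`-part `(L 1 + i L i)/2` equals `c · u(z_c(η₀)) ∂̄V_{η₀}(z_c(η₀))`:
by path additivity `I_c = ` (integral over the fixed segment, holomorphic in `η`) ` + ` (integral
over the short segment). [cite: BruggemanLewisZagier2015, (1.7) p. 10] -/
theorem hasFDerivAt_truncatedCanonical (hu : IsInvariantEigenfunction Γ s u) (hs0 : s ≠ 0)
    (hs1 : s ≠ 1) {z₀ η₀ : ℂ} (hz₀ : 0 < z₀.im) (hη₀ : 0 < η₀.im) (hne : η₀ ≠ z₀) {c : ℝ}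
    (hc : c ∈ Ico (0 : ℝ) 1) :
    ∃ L : ℂ →L[ℝ] ℂ,
      HasFDerivAt (fun η : ℂ => greenSegmentIntegral (u ∘ ofComplex) (ratioKernel s z₀ η) z₀
        ((1 - (c : ℂ)) * z₀ + (c : ℂ) * η)) L η₀ ∧
      (L 1 + Complex.I * L Complex.I) / 2 =
        (c : ℂ) * ((u ∘ ofComplex) ((1 - (c : ℂ)) * z₀ + (c : ℂ) * η₀) *
          wirtingerDzbar (ratioKernel s z₀ η₀) ((1 - (c : ℂ)) * z₀ + (c : ℂ) * η₀)) := by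
  set U : ℂ → ℂ := u ∘ ofComplex with hUdef
  have hU : ContDiffOn ℝ 2 U {z : ℂ | 0 < z.im} := hu.isC2
  obtain ⟨δ, hδ, hgood⟩ := exists_uniform_good_nhd hz₀ hη₀ hne hc
  set b : ℂ := (1 - (c : ℂ)) * z₀ + (c : ℂ) * η₀ with hb
  -- the two pieces and their derivatives
  have hT1 := differentiableAt_greenSegmentIntegral_param s hU hz₀ hη₀ hne hc
  have hT2 := hasFDerivAt_greenSegmentIntegral_short s hU hz₀ hη₀ hne hc
  rw [← hb] at hT1 hT2
  have hT1' := hT1.hasFDerivAt.restrictScalars ℝ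
  have hsum := hT1'.add hT2
  -- path additivity near `η₀`
  have hbgood : (η₀, b) ∈ {q : ℂ × ℂ | 0 < q.2.im ∧ 0 < q.1.im ∧ q.1 ≠ q.2 ∧ q.1 ≠ z₀ ∧
      poissonKernelC q.1 q.2 / poissonKernelC q.1 z₀ ∈ Complex.slitPlane} :=
    hgood η₀ (Metric.mem_ball_self hδ) b (Metric.self_subset_thickening hδ _ (right_mem_segment ℝ z₀ b))
  have hsplit : ∀ᶠ η in 𝓝 η₀,
      greenSegmentIntegral U (ratioKernel s z₀ η) z₀ ((1 - (c : ℂ)) * z₀ + (c : ℂ) * η) =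
        greenSegmentIntegral U (ratioKernel s z₀ η) z₀ b +
          greenSegmentIntegral U (ratioKernel s z₀ η) b ((1 - (c : ℂ)) * z₀ + (c : ℂ) * η) := by
    filter_upwards [Metric.ball_mem_nhds η₀ hδ] with η hη
    have hη' : dist η η₀ < δ := hη
    -- the good convex open set: the `δ`-thickening of the segment
    have hOo : IsOpen (Metric.thickening δ (segment ℝ z₀ b)) := Metric.isOpen_thickening
    have hOc : Convex ℝ (Metric.thickening δ (segment ℝ z₀ b)) := (convex_segment z₀ b).thickening δ
    have hOgood : ∀ w ∈ Metric.thickening δ (segment ℝ z₀ b), 0 < w.im ∧ η ≠ w ∧ conj η ≠ w ∧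
        poissonKernelC η w / poissonKernelC η z₀ ∈ Complex.slitPlane := by
      intro w hw
      obtain ⟨h1, h2, h3, -, -, h6⟩ := goodPair_props hz₀ (hgood η hη w hw)
      exact ⟨h1, h2, h3, h6⟩
    have hpz : poissonKernelC η z₀ ≠ 0 := (goodPair_props hz₀ (hgood η hη b
      (Metric.self_subset_thickening hδ _ (right_mem_segment ℝ z₀ b)))).2.2.2.2.1
    have hz₀mem : z₀ ∈ Metric.thickening δ (segment ℝ z₀ b) :=
      Metric.self_subset_thickening hδ _ (left_mem_segment ℝ z₀ b)
    have hbmem : b ∈ Metric.thickening δ (segment ℝ z₀ b) :=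
      Metric.self_subset_thickening hδ _ (right_mem_segment ℝ z₀ b)
    have hcmem : (1 - (c : ℂ)) * z₀ + (c : ℂ) * η ∈ Metric.thickening δ (segment ℝ z₀ b) := by
      rw [Metric.mem_thickening_iff]
      refine ⟨b, right_mem_segment ℝ z₀ b, ?_⟩
      rw [dist_eq_norm, show (1 - (c : ℂ)) * z₀ + (c : ℂ) * η - b = (c : ℂ) * (η - η₀) from by
        rw [hb]; ring, norm_mul, Complex.norm_real, Real.norm_eq_abs, abs_of_nonneg hc.1]
      calc c * ‖η - η₀‖ ≤ 1 * ‖η - η₀‖ := mul_le_mul_of_nonneg_right hc.2.le (norm_nonneg _)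
        _ = dist η η₀ := by rw [one_mul, dist_eq_norm]
        _ < δ := hη'
    exact (greenSegmentIntegral_ratioKernel_triangle hu hs0 hs1 hOo hOc hOgood hpz hz₀mem hbmem
      hcmem).symm
  refine ⟨_, hsum.congr_of_eventuallyEq hsplit, ?_⟩
  -- the `∂̄`-part: the `ℂ`-linear piece contributes nothing
  obtain ⟨hw, hηw, _, hηw', hpz, hslit⟩ := goodPair_props hz₀ hbgood
  simp only [add_apply, smul_apply, ContinuousLinearMap.coe_restrictScalars',
    ContinuousLinearMap.id_apply, ContinuousLinearEquiv.coe_coe, Complex.conjCLE_apply, map_one,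
    Complex.conj_I, smul_eq_mul]
  rw [show (fderiv ℂ (fun η : ℂ => greenSegmentIntegral U (ratioKernel s z₀ η) z₀ b) η₀) Complex.I =
      Complex.I * (fderiv ℂ (fun η : ℂ => greenSegmentIntegral U (ratioKernel s z₀ η) z₀ b) η₀) 1 from by
    rw [← smul_eq_mul, ← map_smul, smul_eq_mul, mul_one],
    wirtingerDzbar_ratioKernel s hw hηw hηw' hpz hslit]
  have hI2 : Complex.I * Complex.I = -1 := Complex.I_mul_I
  linear_combination ((fderiv ℂ (fun η : ℂ => greenSegmentIntegral U (ratioKernel s z₀ η) z₀ b) η₀ 1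
    + (c : ℂ) * (wirtingerDz U b * ratioKernel s z₀ η₀ b)
    - (c : ℂ) * (U b * (ratioKernel s z₀ η₀ b * (s * Complex.I * (η₀ - b) /
        (2 * ((b.im : ℝ) : ℂ) * (η₀ - conj b)))))) / 2) * hI2

end TruncatedDerivative

/-! ## 14. `∂̄ = 0`: holomorphy of the canonical integral `η ↦ ∫_{z₀}^{η} [u, (R_η/R_η(z₀))^s]` -/

section Holomorphy

variable {Γ : Subgroup (GL (Fin 2) ℝ)} {s : ℂ} {u : ℍ → ℂ}

/-- The `∂̄`-part `(L 1 + i L i)/2` of an `ℝ`-linear map `L : ℂ → ℂ` has norm at most `‖L‖`.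
[folklore] -/
theorem norm_dbarPart_le (L : ℂ →L[ℝ] ℂ) : ‖(L 1 + Complex.I * L Complex.I) / 2‖ ≤ ‖L‖ := by
  have h1 : ‖L 1‖ ≤ ‖L‖ := by simpa using L.le_opNorm 1
  have h2 : ‖Complex.I * L Complex.I‖ ≤ ‖L‖ := by
    rw [norm_mul, Complex.norm_I, one_mul]; simpa using L.le_opNorm Complex.I
  rw [norm_div, Complex.norm_two]
  calc ‖L 1 + Complex.I * L Complex.I‖ / 2 ≤ (‖L 1‖ + ‖Complex.I * L Complex.I‖) / 2 := by
        gcongr; exact norm_add_le _ _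
    _ ≤ (‖L‖ + ‖L‖) / 2 := by gcongr
    _ = ‖L‖ := by ring

/-- **Cauchy–Riemann**: a real-differentiable `f : ℂ → ℂ` whose derivative has vanishing
`∂̄`-part is complex-differentiable. [folklore] -/
theorem differentiableAt_complex_of_dbar_zero {f : ℂ → ℂ} {x : ℂ} {L : ℂ →L[ℝ] ℂ}
    (h : HasFDerivAt f L x) (hL : L 1 + Complex.I * L Complex.I = 0) : DifferentiableAt ℂ f x := by
  have hLI : L Complex.I = Complex.I * L 1 := by
    have hI2 : Complex.I * Complex.I = -1 := Complex.I_mul_I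
    linear_combination (-Complex.I) * hL + (L Complex.I) * hI2
  refine (differentiableAt_iff_restrictScalars ℝ h.differentiableAt).mpr
    ⟨ContinuousLinearMap.smulRight (1 : ℂ →L[ℂ] ℂ) (L 1), ?_⟩
  rw [h.fderiv]
  ext z
  · have e : z = z.re • (1 : ℂ) + z.im • Complex.I := by apply Complex.ext <;> simp
    conv_rhs => rw [e]
    rw [map_add, map_smul, map_smul, hLI]
    simp only [ContinuousLinearMap.coe_restrictScalars', ContinuousLinearMap.smulRight_apply,
      one_apply_eq_self, smul_eq_mul, Complex.real_smul]
    apply Complex.ext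
    · simp; ring
    · simp

/-- `∫_c^1 (1-τ)^{-Re s} dτ = (1-c)^{1 - Re s}/(1 - Re s)` bounds `∫_c^1 ‖(1-τ)^{-s}‖`
(`0 ≤ c ≤ 1`, `Re s < 1`). [folklore] -/
theorem integral_norm_one_sub_cpow_le (hs : s.re < 1) {c : ℝ} (hc : c ∈ Icc (0 : ℝ) 1) :
    ∫ τ in c..1, ‖((1 - τ : ℝ) : ℂ) ^ (-s)‖ ≤ (1 - c) ^ (1 - s.re) / (1 - s.re) := by
  have hr : -1 < -s.re := by linarith
  have heq : ∫ τ in c..1, ‖((1 - τ : ℝ) : ℂ) ^ (-s)‖ = ∫ τ in c..1, (1 - τ) ^ (-s.re) := by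
    refine intervalIntegral.integral_congr_uIoo fun τ hτ => ?_
    rw [uIoo_of_le hc.2] at hτ
    have h1 : 0 < 1 - τ := by linarith [hτ.2]
    rw [Complex.norm_cpow_eq_rpow_re_of_pos h1]
    simp
  rw [heq]
  have hsub := intervalIntegral.integral_comp_sub_left (fun x : ℝ => x ^ (-s.re)) (a := c) (b := 1) 1
  simp only [sub_self] at hsub
  rw [hsub, integral_rpow (Or.inl hr)]
  have h1c : 0 ≤ 1 - c := by linarith [hc.2]
  rw [Real.zero_rpow (by linarith), sub_zero, show -s.re + 1 = 1 - s.re by ring]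

attribute [local irreducible] ratioKernel poissonKernelC in
/-- **A uniform bound for the `dz̄`-coefficient at the truncation point**: for `u ∈ E_s^Γ`,
`z₀, η₀ ∈ ℍ`, `η₀ ≠ z₀`, there is `K` with
`‖c · u(z_c) ∂̄V_{η₀}(z_c)‖ ≤ K (1 - c)^{1 - Re s}` for all `0 ≤ c < 1`, `z_c = (1-c) z₀ + c η₀`
(`∂̄V ~ (1-c)^{-s} · (η₀ - z_c) = O((1-c)^{1-s})`: "`O((ζ - z')^{-s})(ζ - z') = o(1)`").
[cite: BruggemanLewisZagier2015, (1.7) p. 10] -/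
theorem exists_bound_dbar_coeff (s : ℂ) {U : ℂ → ℂ} (hU : ContDiffOn ℝ 2 U {z : ℂ | 0 < z.im})
    {z₀ η₀ : ℂ} (hz₀ : 0 < z₀.im) (hη₀ : 0 < η₀.im) (hne : η₀ ≠ z₀) :
    ∃ K : ℝ, ∀ c ∈ Ico (0 : ℝ) 1,
      ‖(c : ℂ) * (U ((1 - (c : ℂ)) * z₀ + (c : ℂ) * η₀) *
        wirtingerDzbar (ratioKernel s z₀ η₀) ((1 - (c : ℂ)) * z₀ + (c : ℂ) * η₀))‖ ≤
        K * (1 - c) ^ (1 - s.re) := by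
  -- the continuous factor `Q(c) = U(z_c) · W(c)^s · s i (η₀ - z₀)/(2 Im z_c (η₀ - z̄_c))` on `[0,1]`
  set Q : ℝ → ℂ := fun c =>
    U ((1 - (c : ℂ)) * z₀ + (c : ℂ) * η₀) *
      (((((((1 - (c : ℂ)) * z₀ + (c : ℂ) * η₀).im / z₀.im : ℝ) : ℂ) *
        ((η₀ - conj z₀) / (η₀ - conj ((1 - (c : ℂ)) * z₀ + (c : ℂ) * η₀)))) ^ s *
      (s * Complex.I * (η₀ - z₀) /
        (2 * (((((1 - (c : ℂ)) * z₀ + (c : ℂ) * η₀).im : ℝ)) : ℂ) *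
          (η₀ - conj ((1 - (c : ℂ)) * z₀ + (c : ℂ) * η₀)))))) with hQ
  have hO : IsOpen {z : ℂ | 0 < z.im} := isOpen_upperHalfPlaneSet
  have hmaps : MapsTo (fun c : ℝ => (1 - (c : ℂ)) * z₀ + (c : ℂ) * η₀) (Icc 0 1) {z : ℂ | 0 < z.im} :=
    fun c hc => lt_of_lt_of_le (lt_min hz₀ hη₀) (segment_im_ge hc)
  have hQc : ContinuousOn Q (Icc 0 1) := by
    have h1 : ContinuousOn (fun c : ℝ => U ((1 - (c : ℂ)) * z₀ + (c : ℂ) * η₀)) (Icc 0 1) :=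
      hU.continuousOn.comp (continuous_segmentMap z₀ η₀).continuousOn hmaps
    have h2 := continuousOn_segmentW_cpow s hz₀ hη₀ (z₀ := z₀) (η := η₀)
    have h3 : ContinuousOn (fun c : ℝ => s * Complex.I * (η₀ - z₀) /
        (2 * (((((1 - (c : ℂ)) * z₀ + (c : ℂ) * η₀).im : ℝ)) : ℂ) *
          (η₀ - conj ((1 - (c : ℂ)) * z₀ + (c : ℂ) * η₀)))) (Icc 0 1) := by
      apply ContinuousOn.div continuousOn_const
      · exact ((continuousOn_const.mul (Complex.continuous_ofReal.comp_continuousOn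
          (Complex.continuous_im.comp (continuous_segmentMap z₀ η₀)).continuousOn)).mul
          (continuous_const.sub (Complex.continuous_conj.comp (continuous_segmentMap z₀ η₀))).continuousOn)
      · intro c hc
        have hy' : 0 < ((1 - (c : ℂ)) * z₀ + (c : ℂ) * η₀).im :=
          lt_of_lt_of_le (lt_min hz₀ hη₀) (segment_im_ge hc)
        refine mul_ne_zero (mul_ne_zero two_ne_zero (by exact_mod_cast hy'.ne')) ?_
        intro h
        have := congrArg Complex.im h
        simp at this
        nlinarith [mul_nonneg (sub_nonneg.2 hc.2) hz₀.le, mul_nonneg hc.1 hη₀.le, hη₀]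
    exact h1.mul (h2.mul h3)
  obtain ⟨K, hK⟩ := isCompact_Icc.exists_bound_of_continuousOn hQc
  refine ⟨max K 0, fun c hc => ?_⟩
  have hc' : c ∈ Icc (0 : ℝ) 1 := Ico_subset_Icc_self hc
  obtain ⟨hslit, hηz, hηzc, hy'⟩ := ratioBase_segment_mem_slitPlane hz₀ hη₀ hne hc
  have hηz' : η₀ ≠ conj ((1 - (c : ℂ)) * z₀ + (c : ℂ) * η₀) := by
    intro h; have := congrArg Complex.im h; simp at this
    nlinarith [mul_nonneg (sub_nonneg.2 hc'.2) hz₀.le, mul_nonneg hc'.1 hη₀.le, hη₀]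
  have hpz : poissonKernelC η₀ z₀ ≠ 0 :=
    poissonKernelC_ne_zero hz₀ hne (by intro h; have := congrArg Complex.im h; simp at this; linarith)
  have h1c : 0 < 1 - c := by linarith [hc.2]
  -- the identity `c · U ∂̄V = c (1-c)^{-s} (1-c) Q(c)`
  have hval : (c : ℂ) * (U ((1 - (c : ℂ)) * z₀ + (c : ℂ) * η₀) *
      wirtingerDzbar (ratioKernel s z₀ η₀) ((1 - (c : ℂ)) * z₀ + (c : ℂ) * η₀)) =
      (c : ℂ) * ((1 - c : ℝ) : ℂ) ^ (-s) * ((1 - c : ℝ) : ℂ) * Q c := by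
    rw [wirtingerDzbar_ratioKernel s hy' hηz hηz' hpz hslit, ratioKernel_segment s hz₀ hη₀ hne hc,
      show η₀ - ((1 - (c : ℂ)) * z₀ + (c : ℂ) * η₀) = (1 - (c : ℂ)) * (η₀ - z₀) from by ring]
    simp only [hQ]
    push_cast
    ring
  rw [hval, norm_mul, norm_mul, norm_mul, Complex.norm_real, Complex.norm_real, Real.norm_eq_abs,
    Real.norm_eq_abs, abs_of_nonneg hc.1, abs_of_pos h1c, Complex.norm_cpow_eq_rpow_re_of_pos h1c]
  simp only [Complex.neg_re]
  have hQb : ‖Q c‖ ≤ max K 0 := (hK c hc').trans (le_max_left _ _)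
  have hpow : (1 - c) ^ (-s.re) * (1 - c) = (1 - c) ^ (1 - s.re) := by
    rw [show (1 : ℝ) - s.re = -s.re + 1 by ring, Real.rpow_add h1c, Real.rpow_one]
  calc c * (1 - c) ^ (-s.re) * (1 - c) * ‖Q c‖ ≤ 1 * (1 - c) ^ (-s.re) * (1 - c) * max K 0 := by
        gcongr
        · exact hc.2.le
    _ = max K 0 * (1 - c) ^ (1 - s.re) := by rw [one_mul, hpow]; ring

attribute [local irreducible] ratioKernel poissonKernelC in
/-- **Holomorphy of the canonical representative** (companion paper, Theorem 4.2: "Hence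
`h(·, z)` is holomorphic on `ℍ ∖ {z}`"): for `u ∈ E_s^Γ` (`0 < Re s < 1` gives `s ≠ 0, 1`,
`Re s < 1`) and `z₀ ∈ ℍ`, the canonical integral `η ↦ ∫_{z₀}^{η} [u, (R_η/R_η(z₀))^s]` is
complex differentiable at every `η₀ ∈ ℍ ∖ {z₀}`. Proof: the `∂̄`-part of its real derivative is
`c u(z_c) ∂̄V_{η₀}(z_c) + ` (tail derivative) ` = O((1-c)^{1 - Re s})` for every truncation
`0 < c < 1`, hence vanishes. [cite: BruggemanLewisZagier2015, (1.7) p. 10] -/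
theorem differentiableAt_canonicalIntegral (hu : IsInvariantEigenfunction Γ s u) (hs : s.re < 1)
    (hs0 : s ≠ 0) (hs1 : s ≠ 1) {z₀ η₀ : ℂ} (hz₀ : 0 < z₀.im) (hη₀ : 0 < η₀.im) (hne : η₀ ≠ z₀) :
    DifferentiableAt ℂ (fun η : ℂ =>
      greenSegmentIntegral (u ∘ ofComplex) (ratioKernel s z₀ η) z₀ η) η₀ := by
  set U : ℂ → ℂ := u ∘ ofComplex with hUdef
  have hU : ContDiffOn ℝ 2 U {z : ℂ | 0 < z.im} := hu.isC2
  -- the regular part, its domain and the weight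
  set G : ℝ × ℂ → ℂ := fun x : ℝ × ℂ =>
      (((((1 - (x.1 : ℂ)) * z₀ + (x.1 : ℂ) * x.2).im / z₀.im : ℝ) : ℂ) *
          ((x.2 - conj z₀) / (x.2 - conj ((1 - (x.1 : ℂ)) * z₀ + (x.1 : ℂ) * x.2)))) ^ s *
        (wirtingerDz U ((1 - (x.1 : ℂ)) * z₀ + (x.1 : ℂ) * x.2) * (x.2 - z₀) +
          ((1 - x.1 : ℝ) : ℂ) * U ((1 - (x.1 : ℂ)) * z₀ + (x.1 : ℂ) * x.2) *
            (s * Complex.I * (x.2 - z₀) * conj (x.2 - z₀) /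
              (2 * (((((1 - (x.1 : ℂ)) * z₀ + (x.1 : ℂ) * x.2).im : ℝ)) : ℂ) *
                (x.2 - conj ((1 - (x.1 : ℂ)) * z₀ + (x.1 : ℂ) * x.2))))) with hG
  set Ω : Set (ℝ × ℂ) := {x : ℝ × ℂ | 0 < x.2.im ∧ 0 < ((1 - (x.1 : ℂ)) * z₀ + (x.1 : ℂ) * x.2).im ∧
        (((((1 - (x.1 : ℂ)) * z₀ + (x.1 : ℂ) * x.2).im / z₀.im : ℝ) : ℂ) *
          ((x.2 - conj z₀) / (x.2 - conj ((1 - (x.1 : ℂ)) * z₀ + (x.1 : ℂ) * x.2)))) ∈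
            Complex.slitPlane} with hΩ
  set p : ℝ → ℂ := fun τ => ((1 - τ : ℝ) : ℂ) ^ (-s) with hp
  have hΩo : IsOpen Ω := isOpen_regularPartDomain z₀
  have hGreg : ContDiffOn ℝ 1 G Ω := contDiffOn_regularPart s hU z₀
  have hK : Icc (0 : ℝ) 1 ×ˢ ({η₀} : Set ℂ) ⊆ Ω := segmentSlice_subset_regularPartDomain hz₀ hη₀
  have hpint : IntervalIntegrable p volume 0 1 := intervalIntegrable_one_sub_cpow hs
  obtain ⟨r, hr, M, hM0, htube, -, hD⟩ :=
    hasFDerivAt_integral_mul_of_contDiffOn hΩo hGreg zero_le_one hK hpint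
  -- the pointwise identity `[u, V_η](z_τ)(η - z₀) = p(τ) G(τ, η)` for `τ ∈ [0,1)`, `η ∈ ℍ ∖ {z₀}`
  have hident : ∀ η : ℂ, 0 < η.im → η ≠ z₀ → ∀ τ ∈ Ico (0 : ℝ) 1,
      greenForm U (ratioKernel s z₀ η) ((1 - (τ : ℂ)) * z₀ + (τ : ℂ) * η) (η - z₀) = p τ * G (τ, η) :=
    fun η hη hηz τ hτ => greenForm_ratioKernel_segment s (U := U) hz₀ hη hηz hτ
  -- points near `η₀` stay in `ℍ ∖ {z₀}`
  have hnear : ∀ᶠ η in 𝓝 η₀, 0 < η.im ∧ η ≠ z₀ := by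
    filter_upwards [(isOpen_lt continuous_const Complex.continuous_im).mem_nhds hη₀,
      isOpen_ne.mem_nhds hne] with η h1 h2
    exact ⟨h1, h2⟩
  -- the full integral as `∫ p G`
  have hfull : ∀ᶠ η in 𝓝 η₀, greenSegmentIntegral U (ratioKernel s z₀ η) z₀ η =
      ∫ τ in (0:ℝ)..1, p τ * G (τ, η) := by
    filter_upwards [hnear] with η hη
    unfold greenSegmentIntegral
    refine intervalIntegral.integral_congr_uIoo fun τ hτ => ?_
    rw [uIoo_of_le zero_le_one] at hτ
    exact hident η hη.1 hη.2 τ ⟨hτ.1.le, hτ.2⟩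
  -- the derivative of the full integral
  obtain ⟨hfullD, -⟩ := hD 0 1 le_rfl zero_le_one le_rfl
  set L : ℂ →L[ℝ] ℂ := ∫ τ in (0:ℝ)..1, p τ • (fderiv ℝ G (τ, η₀)).comp
    (ContinuousLinearMap.inr ℝ ℝ ℂ) with hL
  have hmain : HasFDerivAt (fun η : ℂ => greenSegmentIntegral U (ratioKernel s z₀ η) z₀ η) L η₀ :=
    hfullD.congr_of_eventuallyEq hfull
  -- it suffices to show that the `∂̄`-part of `L` vanishes
  suffices hβ : L 1 + Complex.I * L Complex.I = 0 from differentiableAt_complex_of_dbar_zero hmain hβ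
  -- integrability of `p G(·, η₀)` on subintervals
  have hslice : ContinuousOn (fun τ : ℝ => G (τ, η₀)) (Icc 0 1) :=
    hGreg.continuousOn.comp (by fun_prop) fun τ hτ => htube ⟨hτ, Metric.mem_closedBall_self hr.le⟩
  have hintsub : ∀ a' b' : ℝ, 0 ≤ a' → a' ≤ b' → b' ≤ 1 →
      IntervalIntegrable (fun τ => p τ * G (τ, η₀)) volume a' b' := by
    intro a' b' h1 h2 h3
    refine (hpint.mono_set ?_).mul_continuousOn ?_
    · rw [uIcc_of_le zero_le_one, uIcc_of_le h2]; exact Icc_subset_Icc h1 h3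
    · rw [uIcc_of_le h2]; exact hslice.mono (Icc_subset_Icc h1 h3)
  -- the bound for the `∂̄`-part, for every truncation `c ∈ (0,1)`
  obtain ⟨Kc, hKc⟩ := exists_bound_dbar_coeff s hU hz₀ hη₀ hne
  have hbound : ∀ c ∈ Ioo (0 : ℝ) 1,
      ‖(L 1 + Complex.I * L Complex.I) / 2‖ ≤
        Kc * (1 - c) ^ (1 - s.re) + M * ((1 - c) ^ (1 - s.re) / (1 - s.re)) := by
    intro c hc
    have hc' : c ∈ Ico (0 : ℝ) 1 := ⟨hc.1.le, hc.2⟩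
    obtain ⟨hDc, -⟩ := hD 0 c le_rfl hc.1.le hc.2.le
    obtain ⟨hDt, hDtb⟩ := hD c 1 hc.1.le hc.2.le le_rfl
    -- the truncated integral and its geometric derivative
    obtain ⟨Lc, hLc, hβc⟩ := hasFDerivAt_truncatedCanonical hu hs0 hs1 hz₀ hη₀ hne hc'
    have htrunc : ∀ᶠ η in 𝓝 η₀,
        (∫ τ in (0:ℝ)..c, p τ * G (τ, η)) =
          greenSegmentIntegral U (ratioKernel s z₀ η) z₀ ((1 - (c : ℂ)) * z₀ + (c : ℂ) * η) := by
      filter_upwards [hnear] with η hη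
      rw [← integral_greenForm_truncate]
      refine intervalIntegral.integral_congr fun τ hτ => ?_
      rw [uIcc_of_le hc.1.le] at hτ
      exact (hident η hη.1 hη.2 τ ⟨hτ.1, lt_of_le_of_lt hτ.2 hc.2⟩).symm
    have hLc' : HasFDerivAt (fun η : ℂ => ∫ τ in (0:ℝ)..c, p τ * G (τ, η)) Lc η₀ :=
      hLc.congr_of_eventuallyEq htrunc
    have hEq1 : (∫ τ in (0:ℝ)..c, p τ • (fderiv ℝ G (τ, η₀)).comp (ContinuousLinearMap.inr ℝ ℝ ℂ)) =
        Lc := hDc.unique hLc'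
    -- splitting the full derivative
    have hsplitD : L = Lc + ∫ τ in c..1, p τ • (fderiv ℝ G (τ, η₀)).comp
        (ContinuousLinearMap.inr ℝ ℝ ℂ) := by
      have hadd : HasFDerivAt (fun η : ℂ => (∫ τ in (0:ℝ)..c, p τ * G (τ, η)) +
          ∫ τ in c..1, p τ * G (τ, η)) (Lc + ∫ τ in c..1, p τ • (fderiv ℝ G (τ, η₀)).comp
            (ContinuousLinearMap.inr ℝ ℝ ℂ)) η₀ := hLc'.add hDt
      have hev : ∀ᶠ η in 𝓝 η₀, (∫ τ in (0:ℝ)..c, p τ * G (τ, η)) + (∫ τ in c..1, p τ * G (τ, η)) =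
          ∫ τ in (0:ℝ)..1, p τ * G (τ, η) := by
        -- integrability near `η₀` along slices
        have hball : Metric.ball η₀ r ∈ 𝓝 η₀ := Metric.ball_mem_nhds η₀ hr
        filter_upwards [hball] with η hη
        have hsl : ContinuousOn (fun τ : ℝ => G (τ, η)) (Icc 0 1) :=
          hGreg.continuousOn.comp (by fun_prop) fun τ hτ =>
            htube ⟨hτ, Metric.ball_subset_closedBall hη⟩
        have hi : ∀ a' b' : ℝ, 0 ≤ a' → a' ≤ b' → b' ≤ 1 →
            IntervalIntegrable (fun τ => p τ * G (τ, η)) volume a' b' := by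
          intro a' b' h1 h2 h3
          refine (hpint.mono_set ?_).mul_continuousOn ?_
          · rw [uIcc_of_le zero_le_one, uIcc_of_le h2]; exact Icc_subset_Icc h1 h3
          · rw [uIcc_of_le h2]; exact hsl.mono (Icc_subset_Icc h1 h3)
        exact intervalIntegral.integral_add_adjacent_intervals (hi 0 c le_rfl hc.1.le hc.2.le)
          (hi c 1 hc.1.le hc.2.le le_rfl)
      exact hfullD.unique (hadd.congr_of_eventuallyEq (hev.mono fun η hη => hη.symm))
    -- the `∂̄`-parts
    have hsplitβ : (L 1 + Complex.I * L Complex.I) / 2 =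
        (Lc 1 + Complex.I * Lc Complex.I) / 2 +
          ((∫ τ in c..1, p τ • (fderiv ℝ G (τ, η₀)).comp (ContinuousLinearMap.inr ℝ ℝ ℂ)) 1 +
            Complex.I * (∫ τ in c..1, p τ • (fderiv ℝ G (τ, η₀)).comp
              (ContinuousLinearMap.inr ℝ ℝ ℂ)) Complex.I) / 2 := by
      rw [hsplitD]; simp only [add_apply]; ring
    rw [hsplitβ, hβc]
    have htail := norm_dbarPart_le (∫ τ in c..1, p τ • (fderiv ℝ G (τ, η₀)).comp
      (ContinuousLinearMap.inr ℝ ℝ ℂ))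
    have hpn := integral_norm_one_sub_cpow_le hs (Ico_subset_Icc_self hc')
    calc _ ≤ ‖(c : ℂ) * (U ((1 - (c : ℂ)) * z₀ + (c : ℂ) * η₀) *
            wirtingerDzbar (ratioKernel s z₀ η₀) ((1 - (c : ℂ)) * z₀ + (c : ℂ) * η₀))‖ +
          ‖((∫ τ in c..1, p τ • (fderiv ℝ G (τ, η₀)).comp (ContinuousLinearMap.inr ℝ ℝ ℂ)) 1 +
            Complex.I * (∫ τ in c..1, p τ • (fderiv ℝ G (τ, η₀)).comp
              (ContinuousLinearMap.inr ℝ ℝ ℂ)) Complex.I) / 2‖ := norm_add_le _ _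
      _ ≤ Kc * (1 - c) ^ (1 - s.re) + M * ((1 - c) ^ (1 - s.re) / (1 - s.re)) := by
          gcongr
          · exact hKc c hc'
          · exact htail.trans (hDtb.trans (by gcongr))
  -- let `c → 1⁻`
  have htend : Tendsto (fun c : ℝ => Kc * (1 - c) ^ (1 - s.re) + M * ((1 - c) ^ (1 - s.re) / (1 - s.re)))
      (𝓝[<] 1) (𝓝 0) := by
    have hexp : 0 < 1 - s.re := by linarith
    have h1 : Tendsto (fun c : ℝ => (1 - c) ^ (1 - s.re)) (𝓝[<] 1) (𝓝 0) := by
      have hsub : Tendsto (fun c : ℝ => 1 - c) (𝓝[<] 1) (𝓝[>] 0) := by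
        refine tendsto_nhdsWithin_of_tendsto_nhds_of_eventually_within _ ?_ ?_
        · have : Tendsto (fun c : ℝ => 1 - c) (𝓝 1) (𝓝 (1 - 1)) :=
            (tendsto_const_nhds.sub tendsto_id)
          rw [sub_self] at this
          exact this.mono_left nhdsWithin_le_nhds
        · filter_upwards [self_mem_nhdsWithin] with c hc
          exact sub_pos.mpr (Set.mem_Iio.mp hc)
      have hpow : Tendsto (fun x : ℝ => x ^ (1 - s.re)) (𝓝[>] 0) (𝓝 0) := by
        have := Real.continuousAt_rpow_const 0 (1 - s.re) (Or.inr hexp.le)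
        have h0 : (0 : ℝ) ^ (1 - s.re) = 0 := Real.zero_rpow hexp.ne'
        rw [ContinuousAt, h0] at this
        exact this.mono_left nhdsWithin_le_nhds
      exact hpow.comp hsub
    have := (h1.const_mul Kc).add ((h1.div_const (1 - s.re)).const_mul M)
    simpa using this
  have hle : ∀ᶠ c in 𝓝[<] (1 : ℝ), ‖(L 1 + Complex.I * L Complex.I) / 2‖ ≤
      Kc * (1 - c) ^ (1 - s.re) + M * ((1 - c) ^ (1 - s.re) / (1 - s.re)) := by
    have hmem : Ioo (1 / 2 : ℝ) 1 ∈ 𝓝[<] (1 : ℝ) := Ioo_mem_nhdsLT (by norm_num)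
    filter_upwards [hmem] with c hc
    exact hbound c ⟨by linarith [hc.1], hc.2⟩
  have hnorm : ‖(L 1 + Complex.I * L Complex.I) / 2‖ ≤ 0 :=
    ge_of_tendsto htend hle
  have hzero : (L 1 + Complex.I * L Complex.I) / 2 = 0 := norm_le_zero_iff.mp hnorm
  have : L 1 + Complex.I * L Complex.I = 2 * ((L 1 + Complex.I * L Complex.I) / 2) := by ring
  rw [this, hzero, mul_zero]

end Holomorphy

/-! ## 15. The canonical integral at the base point; holomorphy on all of `ℍ`

The regular part `G(τ, η)` of the canonical integrand vanishes identically at `η = z₀` and is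
jointly `C¹` (§12), so `‖G(τ, η)‖ ≤ M ‖η - z₀‖` for `|η - z₀| ≤ Im z₀ / 2` (mean value
inequality), whence `‖∫_{z₀}^{η} [u, (R_η/R_η(z₀))^s]‖ ≤ M ‖η - z₀‖ / (1 - Re s)`: the canonical
integral is continuous at `z₀` (value `0`) and the removable singularity theorem upgrades §14 to
holomorphy on all of `ℍ` (companion paper, Thm 4.2). -/

section BasePoint

variable {Γ : Subgroup (GL (Fin 2) ℝ)} {s : ℂ} {u : ℍ → ℂ}

/-- Points of the closed ball of radius `Im z₀ / 2` around `z₀` have imaginary part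
`≥ Im z₀ / 2`. [folklore] -/
theorem half_im_le_of_mem_closedBall {z₀ η : ℂ} (hη : η ∈ Metric.closedBall z₀ (z₀.im / 2)) :
    z₀.im / 2 ≤ η.im := by
  have h1 : |(η - z₀).im| ≤ ‖η - z₀‖ := Complex.abs_im_le_norm _
  rw [Metric.mem_closedBall, dist_eq_norm] at hη
  have h2 : (η - z₀).im = η.im - z₀.im := by simp
  rw [h2] at h1
  have := (abs_le.mp (h1.trans hη)).1
  linarith

/-- **Lipschitz bound for the regular part at the base point**: `‖G(τ, η)‖ ≤ M ‖η - z₀‖` for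
`τ ∈ [0, 1]` and `|η - z₀| ≤ Im z₀ / 2` (`G(τ, z₀) = 0` and `G` is `C¹`, §12). [folklore] -/
theorem exists_norm_regularPart_le (s : ℂ) {U : ℂ → ℂ} (hU : ContDiffOn ℝ 2 U {z : ℂ | 0 < z.im})
    {z₀ : ℂ} (hz₀ : 0 < z₀.im) :
    ∃ M : ℝ, 0 ≤ M ∧ ∀ τ ∈ Icc (0 : ℝ) 1, ∀ η ∈ Metric.closedBall z₀ (z₀.im / 2),
      ‖(((((1 - (τ : ℂ)) * z₀ + (τ : ℂ) * η).im / z₀.im : ℝ) : ℂ) *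
          ((η - conj z₀) / (η - conj ((1 - (τ : ℂ)) * z₀ + (τ : ℂ) * η)))) ^ s *
        (wirtingerDz U ((1 - (τ : ℂ)) * z₀ + (τ : ℂ) * η) * (η - z₀) +
          ((1 - τ : ℝ) : ℂ) * U ((1 - (τ : ℂ)) * z₀ + (τ : ℂ) * η) *
            (s * Complex.I * (η - z₀) * conj (η - z₀) /
              (2 * (((((1 - (τ : ℂ)) * z₀ + (τ : ℂ) * η).im : ℝ)) : ℂ) *
                (η - conj ((1 - (τ : ℂ)) * z₀ + (τ : ℂ) * η)))))‖ ≤ M * ‖η - z₀‖ := by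
  set G : ℝ × ℂ → ℂ := fun x : ℝ × ℂ =>
      (((((1 - (x.1 : ℂ)) * z₀ + (x.1 : ℂ) * x.2).im / z₀.im : ℝ) : ℂ) *
          ((x.2 - conj z₀) / (x.2 - conj ((1 - (x.1 : ℂ)) * z₀ + (x.1 : ℂ) * x.2)))) ^ s *
        (wirtingerDz U ((1 - (x.1 : ℂ)) * z₀ + (x.1 : ℂ) * x.2) * (x.2 - z₀) +
          ((1 - x.1 : ℝ) : ℂ) * U ((1 - (x.1 : ℂ)) * z₀ + (x.1 : ℂ) * x.2) *
            (s * Complex.I * (x.2 - z₀) * conj (x.2 - z₀) /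
              (2 * (((((1 - (x.1 : ℂ)) * z₀ + (x.1 : ℂ) * x.2).im : ℝ)) : ℂ) *
                (x.2 - conj ((1 - (x.1 : ℂ)) * z₀ + (x.1 : ℂ) * x.2))))) with hG
  set Ω : Set (ℝ × ℂ) := {x : ℝ × ℂ | 0 < x.2.im ∧ 0 < ((1 - (x.1 : ℂ)) * z₀ + (x.1 : ℂ) * x.2).im ∧
        (((((1 - (x.1 : ℂ)) * z₀ + (x.1 : ℂ) * x.2).im / z₀.im : ℝ) : ℂ) *
          ((x.2 - conj z₀) / (x.2 - conj ((1 - (x.1 : ℂ)) * z₀ + (x.1 : ℂ) * x.2)))) ∈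
            Complex.slitPlane} with hΩ
  have hGd : ContDiffOn ℝ 1 G Ω := contDiffOn_regularPart s hU z₀
  have hΩo : IsOpen Ω := isOpen_regularPartDomain z₀
  set K : Set (ℝ × ℂ) := Icc (0 : ℝ) 1 ×ˢ Metric.closedBall z₀ (z₀.im / 2) with hK
  have hKc : IsCompact K := isCompact_Icc.prod (isCompact_closedBall _ _)
  have hKΩ : K ⊆ Ω := by
    rintro ⟨τ, η⟩ ⟨hτ, hη⟩
    have hηim : 0 < η.im := by have := half_im_le_of_mem_closedBall hη; linarith
    exact segmentSlice_subset_regularPartDomain hz₀ hηim ⟨hτ, rfl⟩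
  have hcont : ContinuousOn (fun x => fderiv ℝ G x) K :=
    (hGd.continuousOn_fderiv_of_isOpen hΩo le_rfl).mono hKΩ
  obtain ⟨M, hM⟩ := hKc.exists_bound_of_continuousOn hcont
  refine ⟨max M 0, le_max_right _ _, fun τ hτ η hη => ?_⟩
  have hconv : Convex ℝ (Metric.closedBall z₀ (z₀.im / 2)) := convex_closedBall _ _
  have hz₀mem : z₀ ∈ Metric.closedBall z₀ (z₀.im / 2) :=
    Metric.mem_closedBall_self (by positivity)
  have hderiv : ∀ η' ∈ Metric.closedBall z₀ (z₀.im / 2),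
      HasFDerivWithinAt (fun η' : ℂ => G (τ, η'))
        ((fderiv ℝ G (τ, η')).comp (ContinuousLinearMap.inr ℝ ℝ ℂ))
        (Metric.closedBall z₀ (z₀.im / 2)) η' := by
    intro η' hη'
    have hmem : (τ, η') ∈ Ω := hKΩ ⟨hτ, hη'⟩
    have hdiff : DifferentiableAt ℝ G (τ, η') :=
      (hGd.differentiableOn one_ne_zero (τ, η') hmem).differentiableAt (hΩo.mem_nhds hmem)
    exact (hdiff.hasFDerivAt.comp η' (hasFDerivAt_prodMk_right τ η')).hasFDerivWithinAt
  have hbound : ∀ η' ∈ Metric.closedBall z₀ (z₀.im / 2),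
      ‖(fderiv ℝ G (τ, η')).comp (ContinuousLinearMap.inr ℝ ℝ ℂ)‖ ≤ max M 0 := by
    intro η' hη'
    have hMx := hM (τ, η') ⟨hτ, hη'⟩
    calc ‖(fderiv ℝ G (τ, η')).comp (ContinuousLinearMap.inr ℝ ℝ ℂ)‖
        ≤ ‖fderiv ℝ G (τ, η')‖ * ‖ContinuousLinearMap.inr ℝ ℝ ℂ‖ :=
          ContinuousLinearMap.opNorm_comp_le _ _
      _ ≤ max M 0 * 1 := by
          apply mul_le_mul (hMx.trans (le_max_left _ _)) (ContinuousLinearMap.norm_inr_le_one ℝ ℝ ℂ)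
            (norm_nonneg _) (le_max_right _ _)
      _ = max M 0 := mul_one _
  have hmv := hconv.norm_image_sub_le_of_norm_hasFDerivWithin_le hderiv hbound hz₀mem hη
  have hG0 : G (τ, z₀) = 0 := by simp [hG]
  rw [hG0, sub_zero] at hmv
  exact hmv

/-- **The canonical integral is `O(|η - z₀|)` at the base point**:
`‖∫_{z₀}^{η} [U, (R_η/R_η(z₀))^s]‖ ≤ C |η - z₀|` for `|η - z₀| ≤ Im z₀ / 2` (`Re s < 1`).
[cite: BruggemanLewisZagier2015, (1.7) p. 10] -/
theorem exists_norm_canonicalIntegral_le (hs : s.re < 1) {U : ℂ → ℂ}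
    (hU : ContDiffOn ℝ 2 U {z : ℂ | 0 < z.im}) {z₀ : ℂ} (hz₀ : 0 < z₀.im) :
    ∃ C : ℝ, ∀ η ∈ Metric.closedBall z₀ (z₀.im / 2),
      ‖greenSegmentIntegral U (ratioKernel s z₀ η) z₀ η‖ ≤ C * ‖η - z₀‖ := by
  obtain ⟨M, hM0, hM⟩ := exists_norm_regularPart_le s hU hz₀
  refine ⟨M / (1 - s.re), fun η hη => ?_⟩
  rcases eq_or_ne η z₀ with rfl | hne
  · simp
  have hηim : 0 < η.im := by have := half_im_le_of_mem_closedBall hη; linarith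
  have hs' : 0 < 1 - s.re := by linarith
  rw [greenSegmentIntegral]
  have h1 : ∀ᵐ t : ℝ, t ≠ 1 := by
    rw [ae_iff]
    simp
  have hle : ∀ᵐ t : ℝ, t ∈ Ioc (0 : ℝ) 1 →
      ‖greenForm U (ratioKernel s z₀ η) ((1 - (t : ℂ)) * z₀ + (t : ℂ) * η) (η - z₀)‖ ≤
        ‖((1 - t : ℝ) : ℂ) ^ (-s)‖ * (M * ‖η - z₀‖) := by
    filter_upwards [h1] with t ht1 ht
    have hτ : t ∈ Ico (0 : ℝ) 1 := ⟨ht.1.le, lt_of_le_of_ne ht.2 ht1⟩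
    rw [greenForm_ratioKernel_segment s hz₀ hηim hne hτ, norm_mul]
    exact mul_le_mul_of_nonneg_left (hM t ⟨ht.1.le, ht.2⟩ η hη) (norm_nonneg _)
  have hint : IntervalIntegrable (fun t : ℝ => ‖((1 - t : ℝ) : ℂ) ^ (-s)‖ * (M * ‖η - z₀‖))
      volume 0 1 :=
    (intervalIntegrable_one_sub_cpow hs).norm.mul_const _
  have hI0 : ∫ τ in (0 : ℝ)..1, ‖((1 - τ : ℝ) : ℂ) ^ (-s)‖ ≤ 1 / (1 - s.re) := by
    have := integral_norm_one_sub_cpow_le hs (c := 0) ⟨le_rfl, zero_le_one⟩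
    rw [sub_zero, Real.one_rpow] at this
    exact this
  calc ‖∫ τ in (0 : ℝ)..1, greenForm U (ratioKernel s z₀ η) ((1 - (τ : ℂ)) * z₀ + (τ : ℂ) * η)
          (η - z₀)‖
      ≤ ∫ τ in (0 : ℝ)..1, ‖((1 - τ : ℝ) : ℂ) ^ (-s)‖ * (M * ‖η - z₀‖) :=
        intervalIntegral.norm_integral_le_of_norm_le zero_le_one hle hint
    _ = (∫ τ in (0 : ℝ)..1, ‖((1 - τ : ℝ) : ℂ) ^ (-s)‖) * (M * ‖η - z₀‖) :=
        intervalIntegral.integral_mul_const _ _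
    _ ≤ (1 / (1 - s.re)) * (M * ‖η - z₀‖) :=
        mul_le_mul_of_nonneg_right hI0 (by positivity)
    _ = M / (1 - s.re) * ‖η - z₀‖ := by ring

/-- **Holomorphy of the canonical integral at the base point** (removable singularity: the
integral is holomorphic on a punctured disc around `z₀` (§14) and `O(|η - z₀|)` there).
[cite: BruggemanLewisZagier2015, Proposition 5.1 pp. 30–31] -/
theorem differentiableAt_canonicalIntegral_base (hu : IsInvariantEigenfunction Γ s u)
    (hs : s.re < 1) (hs0 : s ≠ 0) (hs1 : s ≠ 1) {z₀ : ℂ} (hz₀ : 0 < z₀.im) :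
    DifferentiableAt ℂ (fun η : ℂ =>
      greenSegmentIntegral (u ∘ ofComplex) (ratioKernel s z₀ η) z₀ η) z₀ := by
  have hr : (0 : ℝ) < z₀.im / 2 := by positivity
  have hball : Metric.ball z₀ (z₀.im / 2) ∈ 𝓝 z₀ := Metric.ball_mem_nhds _ hr
  refine ((Complex.differentiableOn_compl_singleton_and_continuousAt_iff hball).1
    ⟨?_, ?_⟩).differentiableAt hball
  · rintro η ⟨hη, hηne⟩
    have hne : η ≠ z₀ := by simpa using hηne
    have hηim : 0 < η.im := by
      have := half_im_le_of_mem_closedBall (Metric.ball_subset_closedBall hη); linarith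
    exact (differentiableAt_canonicalIntegral hu hs hs0 hs1 hz₀ hηim hne).differentiableWithinAt
  · obtain ⟨C, hC⟩ := exists_norm_canonicalIntegral_le hs hu.isC2 hz₀
    have hev : ∀ᶠ η in 𝓝 z₀,
        ‖greenSegmentIntegral (u ∘ ofComplex) (ratioKernel s z₀ η) z₀ η‖ ≤ C * ‖η - z₀‖ := by
      filter_upwards [Metric.closedBall_mem_nhds z₀ hr] with η hη
      exact hC η hη
    have hlim : Tendsto (fun η : ℂ => C * ‖η - z₀‖) (𝓝 z₀) (𝓝 0) := by
      have hc : Continuous (fun η : ℂ => C * ‖η - z₀‖) := by fun_prop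
      simpa using hc.tendsto z₀
    rw [ContinuousAt]
    simp only [greenSegmentIntegral_self]
    exact squeeze_zero_norm' hev hlim

/-- **Holomorphy of the canonical integral on all of `ℍ`** (companion paper, Thm 4.2: the
canonical representative `h(η) = u(z₀) + ∫_{z₀}^{η} [u, (R_η/R_η(z₀))^s]` is holomorphic on `ℍ`).
[cite: BruggemanLewisZagier2015, Proposition 5.1 pp. 30–31] -/
theorem differentiableOn_canonicalIntegral (hu : IsInvariantEigenfunction Γ s u) (hs : s.re < 1)
    (hs0 : s ≠ 0) (hs1 : s ≠ 1) {z₀ : ℂ} (hz₀ : 0 < z₀.im) :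
    DifferentiableOn ℂ (fun η : ℂ =>
      greenSegmentIntegral (u ∘ ofComplex) (ratioKernel s z₀ η) z₀ η) {η : ℂ | 0 < η.im} := by
  intro η₀ hη₀
  by_cases h : η₀ = z₀
  · rw [h]
    exact (differentiableAt_canonicalIntegral_base hu hs hs0 hs1 hz₀).differentiableWithinAt
  · exact (differentiableAt_canonicalIntegral hu hs hs0 hs1 hz₀ hη₀ h).differentiableWithinAt

end BasePoint

/-! ## 16. The conjugate system

`u ∈ E_s^Γ ⇒ ū ∈ E_{s̄}^Γ` (the Laplacian is a real operator), and the Schwarz reflection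
`η ↦ conj (∫_{z₀}^{η̄} [ū, (R_{η̄}/R_{η̄}(z₀))^{s̄}])` of the canonical integral of the conjugate
system is holomorphic on the lower half-plane: this is the lower-half-plane representative
`∫_{z₀}^{η̄} [(R_η/R_η(z₀))^s, u]` of the canonical model (companion paper, §4.2). -/

section ConjugateSystem

variable {Γ : Subgroup (GL (Fin 2) ℝ)} {s : ℂ} {u : ℍ → ℂ}

/-- The hyperbolic Laplacian commutes with complex conjugation. [folklore] -/
theorem hypLaplacian_conj_of_isC2 {u : ℍ → ℂ} (hu : IsC2 u) (z : ℍ) :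
    hypLaplacian (fun w => conj (u w)) z = conj (hypLaplacian u z) := by
  unfold hypLaplacian
  have hcomp : ((fun w => conj (u w)) ∘ ofComplex : ℂ → ℂ) =
      ⇑(Complex.conjCLE : ℂ →L[ℝ] ℂ) ∘ (u ∘ ofComplex) := by
    funext w; simp
  have hcd : ContDiffAt ℝ 2 (u ∘ ofComplex) (z : ℂ) :=
    hu.contDiffAt (isOpen_upperHalfPlaneSet.mem_nhds z.im_pos)
  rw [hcomp, hcd.laplacian_CLM_comp_left]
  simp [Complex.conj_ofReal]

/-- **`u ∈ E_s^Γ ⇒ ū ∈ E_{s̄}^Γ`.** [cite: BruggemanLewisZagier2015, (1.1) p. 8] -/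
theorem IsInvariantEigenfunction.conj (hu : IsInvariantEigenfunction Γ s u) :
    IsInvariantEigenfunction Γ (conj s) (fun z => conj (u z)) where
  isC2 := by
    have hcomp : ((fun w => conj (u w)) ∘ ofComplex : ℂ → ℂ) =
        ⇑(Complex.conjCLE : ℂ →L[ℝ] ℂ) ∘ (u ∘ ofComplex) := by
      funext w; simp
    unfold IsC2
    rw [hcomp]
    exact (Complex.conjCLE : ℂ →L[ℝ] ℂ).contDiff.comp_contDiffOn hu.isC2
  eigen z := by
    rw [hypLaplacian_conj_of_isC2 hu.isC2 z]
    have h := congrArg conj (hu.eigen z)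
    simpa [map_add, map_mul, map_sub] using h
  invariant γ hγ z := by simp [hu.invariant γ hγ z]

/-- **Holomorphy of the lower-half-plane representative**: the Schwarz reflection of the
canonical integral of the conjugate system `(ū, s̄)` is holomorphic on `{Im η < 0}`.
[cite: BruggemanLewisZagier2015, Proposition 5.1 pp. 30–31] -/
theorem differentiableOn_conj_canonicalIntegral (hu : IsInvariantEigenfunction Γ s u)
    (hs : s.re < 1) (hs0 : s ≠ 0) (hs1 : s ≠ 1) {z₀ : ℂ} (hz₀ : 0 < z₀.im) :
    DifferentiableOn ℂ (fun η : ℂ => conj (greenSegmentIntegral ((fun z => conj (u z)) ∘ ofComplex)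
      (ratioKernel (conj s) z₀ (conj η)) z₀ (conj η))) {η : ℂ | η.im < 0} := by
  have hs' : (conj s).re < 1 := by simpa using hs
  have hs0' : conj s ≠ 0 := by simpa using hs0
  have hs1' : conj s ≠ 1 := fun h => hs1 (by simpa using congrArg conj h)
  have hg := differentiableOn_canonicalIntegral hu.conj hs' hs0' hs1' hz₀
  intro η hη
  have hη' : 0 < (conj η).im := by simp only [Complex.conj_im]; simp only [mem_setOf_eq] at hη; linarith
  have hga : DifferentiableAt ℂ (fun ζ : ℂ => greenSegmentIntegral ((fun z => conj (u z)) ∘ ofComplex)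
      (ratioKernel (conj s) z₀ ζ) z₀ ζ) (conj η) :=
    hg.differentiableAt (isOpen_upperHalfPlaneSet.mem_nhds hη')
  have := hga.conj_conj
  rw [Complex.conj_conj] at this
  exact this.differentiableWithinAt

end ConjugateSystem

end Literature.NumberTheory.Automorphic
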